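import Literature.NumberTheory.Sieve.GoldstonGrahamPintzYildirim
import Literature.NumberTheory.Sieve.CoprimeSquarefreeSumsBounds
import Literature.NumberTheory.LFunctions.MertensTail
import Mathlib.NumberTheory.EulerProduct.Basic
import Mathlib.Analysis.Calculus.MeanValue
import HarnessLib

/-!
# Goldston–Graham–Pintz–Yıldırım 2009, Lemma 3 (`κ = 1`) proved: the named fact `GGPY.moebiusSqGSum_asymptotic`

Topic `Literature/NumberTheory/Sieve`; discharges the named fact `Literature.NumberTheory.Sieve.GGPY.moebiusSqGSum_asymptotic` of
`GoldstonGrahamPintzYildirim.lean` (D. A. Goldston, S. W. Graham, J. Pintz, C. Y. Yıldırım, *Small gaps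
between products of two primes*, Proc. LMS (3) 98 (2009) 741–774, **Lemma 3** in dimension `κ = 1`;
"a combination of Lemmas 5.3 and 5.4 of Halberstam and Richert's book"): if `0 ≤ γ(p)/p ≤ 1 − 1/A₁`
(`(Ω₁)`) and `−L ≤ ∑_{w ≤ p < z} γ(p) log p/p − log(z/w) ≤ A₂` for `2 ≤ w ≤ z` (`(Ω₂(1, L))`), then with
`g(d) = ∏_{p∣d} γ(p)/(p − γ(p))` the partial products of `c_γ = ∏_p (1 − γ(p)/p)⁻¹ (1 − 1/p)` converge
and `|∑_{d<z} μ²(d) g(d) − c_γ log z| ≤ C(A₁, A₂) c_γ L` for all `z ≥ 2`, `L ≥ 1`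
(`GGPY.moebiusSqGSum_asymptotic_holds`, at the end of the file). Together with
`GoldstonGrahamPintzYildirimProofs.lean` (Lemma 4 from Lemma 3) this makes Maynard's Lemma 6.1
(`GGPY.moebiusSqGSumWeighted_asymptotic`) unconditional.

## The proof

Halberstam–Richert's book is not held; the proof below is an independent elementary argument
(everything is a finite sum; the only analysis is a fencing argument for a right derivative), organised
in the namespace `Literature.GGPY.Lemma3`. Write `a(d) = μ²(d) g(d) ≥ 0`, `G(x) = ∑_{d ≤ x} a(d)`,
`T(x) = ∑_{d ≤ x} a(d) log(x/d)`, `K = L + O_{A₁,A₂}(1)`.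

* **(a) A Chebyshev-type identity** (`sum_wt_mul_log_eq_main_add_D`): since `a` is supported on
  squarefree integers and `a(pm) = g(p) a(m)` (`p ∤ m`),
  `∑_{d ≤ x} a(d) log d = ∑_{p ≤ x} g(p) log p · G_p(x/p)` with `G_p` the sum over `d` prime to `p`;
  using `G = G_p + g(p) G_p(·/p)` and the exact relation `γ(p)/p = g(p)/(1 + g(p))` this equals
  `∑_{m ≤ x} a(m) θ_γ(x/m) + D(x)`, `θ_γ(y) = ∑_{p ≤ y} γ(p) log p/p = log y + O(L)` (by `(Ω₂)`), with the
  SECOND-ORDER term `D(x) = ∑_p (γ(p) log p/p) g(p) (G_p(x/p) − G_p(x/p²)) ∈ [0, C₁ G(x)]`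
  (`Dterm_le`: after swapping sums, a window sum `∑_{√y < p ≤ y} (γ(p) log p/p) g(p) ≤ C₁`, because
  `(Ω₂)` gives the budget `½ log y + O(1)` on `[√y, y]` while `g(p) ≪ γ(p)/p ≪ 1/log y` there).
  Hence **`|G(x) log x − 2 T(x)| ≤ K G(x)`** (`abs_Gs_mul_log_sub_le`). (A first-order treatment of
  `g(p) log p` would not do: `∑_p g(p)² log p` need not be bounded under `(Ω₂)`.)
* **(b) The slope** (`exists_slope`): in `u = log x`, `T̃' = G̃` from the right and
  `(u − K) G̃ ≤ 2T̃ ≤ (u + K) G̃`, so `T̃/(u − K)²` does not increase and `T̃/(u + K)²` does not decrease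
  (`quad_fence_upper/lower`, via Mathlib's `image_le_of_deriv_right_lt_deriv_boundary`); with
  `c/2 = inf_{u ≥ 2K} T̃/(u − K)²` this pins `(c/2)(u − K)² ≤ T̃ ≤ (c/2)(u + K)²` and then
  `|G̃(u) − c u| ≤ 9 c K` for all `u ≥ 0`.
* **(c) The constant.** Let `γ_y = γ` below `y` and `= 1` from `y` on; these satisfy the same
  hypotheses with `A₂ + 10`, `L + 10` (Mertens: `|∑_{w ≤ p < z} log p/p − log(z/w)| ≤ 10`, from the
  tree's `MertensBound.sum_log_div_prime_bounds`). The slope of `γ_2 ≡ 1` is `1` (`slope_eq_one`: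
  `∑_{n ≤ x} μ²(n)/φ(n) = β(x) log x + O(1)` by the tree's `SquarefreeSums.abs_sum_wfun_div_sub_le`, and
  `β(x) → ∑_n b(n)/n = ∏_p (1 + 1/(p(p−1)) − 1/(p(p−1))) = 1` by Mathlib's Euler product
  `ArithmeticFunction.IsMultiplicative.eulerProduct`); passing from `γ_q` to `γ_{q+1}` multiplies the
  slope by `(1 + g(q))(1 − 1/q) = (1 − γ(q)/q)⁻¹ (1 − 1/q)` (`isSlope_step`, pinching
  `U = ∑_{q ∤ d} a(d)` between `G_q(x)` and `G_q(qx)`); so the slope of `γ_y` is the partial product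
  `cGammaPartial γ y` (`isSlope_trunc`). Finally `G_γ = G_{γ_y}` on `[1, y)`, and (b) for both gives
  `|c − cGammaPartial γ y| log(y − ½) ≤ 9K (c + cGammaPartial γ y)`, whence `cGammaPartial γ y → c`,
  `cGamma γ = c`, and the bound with `C = 10 + 9 C₃(A₁, A₂)`.

## References

* D. A. Goldston, S. W. Graham, J. Pintz, C. Y. Yıldırım, *Small gaps between products of two primes*,
  Proc. Lond. Math. Soc. (3) 98 (2009), 741–774, doi:10.1112/plms/pdn046 = arXiv:math/0609615, §2,
  Lemma 3 (p. 6 of the arXiv text). [GoldstonEtAl2008]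
* H. Halberstam, H.-E. Richert, *Sieve Methods*, Academic Press 1974, Ch. 5, Lemmas 5.3–5.4 (the
  source of Lemma 3; not followed here).
* J. Maynard, *Small gaps between primes*, Ann. of Math. (2) 181 (2015), 383–413, Lemma 6.1 (the
  consumer, through `GoldstonGrahamPintzYildirimProofs.lean` and `MaynardSieveYm.lean`). [MaynardAnnals2015]

## Mathlib / tree

Mathlib: `image_le_of_deriv_right_lt_deriv_boundary` (fencing), `ArithmeticFunction.IsMultiplicative.eulerProduct`,
`Nat.floor_div_natCast`, `summable_of_sum_range_le`. Tree: `Literature.NumberTheory.LFunctions.MertensBound.sum_log_div_prime_bounds`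
(`MertensTail.lean`); `SquarefreeSums.abs_sum_wfun_div_sub_le`, `sum_babs_le`, `bfun_apply_prime_pow`,
`wfun_cTot_div`-type API (`CoprimeSquarefreeSums*.lean`).
-/

noncomputable section

open Finset Filter Real
open scoped Topology ArithmeticFunction.Moebius

namespace Literature.NumberTheory.Sieve
namespace GGPY
namespace Lemma3

variable (γ : ℕ → ℝ)

/-! ### The sums `G`, `G_p`, `T`, `θ_γ` -/

/-- `a(d) = μ(d)² g(d)`, the summand of `G(z) = ∑_{d<z} μ(d)² g(d)`. [cite: GoldstonEtAl2008, Lemma 3] -/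
def wt (d : ℕ) : ℝ := ((μ d : ℤ) : ℝ) ^ 2 * g γ d

/-- `G(x) = ∑_{d ≤ x} μ(d)² g(d)` (real `x`; the closed range `d ≤ x`). [cite: GoldstonEtAl2008, Lemma 3] -/
def Gs (x : ℝ) : ℝ := ∑ d ∈ Icc 1 ⌊x⌋₊, wt γ d

/-- `G_p(x) = ∑_{d ≤ x, p ∤ d} μ(d)² g(d)`. [folklore] -/
def Gcop (p : ℕ) (x : ℝ) : ℝ := ∑ d ∈ (Icc 1 ⌊x⌋₊).filter (fun d => ¬p ∣ d), wt γ d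

/-- `T(x) = ∑_{d ≤ x} μ(d)² g(d) log(x/d) = ∫_1^x G(t) dt/t`. [folklore] -/
def Ts (x : ℝ) : ℝ := ∑ d ∈ Icc 1 ⌊x⌋₊, wt γ d * Real.log (x / d)

/-- `θ_γ(y) = ∑_{p ≤ y} γ(p) log p / p`. [cite: GoldstonEtAl2008, §2 display (2.3)] -/
def theta (y : ℝ) : ℝ := ∑ p ∈ (Icc 1 ⌊y⌋₊).filter Nat.Prime, γ p * Real.log p / p

/-- The window summand `(γ(p) log p / p) · g(p)`. [folklore] -/
def wterm (p : ℕ) : ℝ := γ p * Real.log p / p * g γ p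

/-- `D(x) = ∑_{p ≤ x} (γ(p) log p/p) g(p) (G_p(x/p) − G_p(x/p²)) ≥ 0`, the second-order term of the
Chebyshev-type identity for `∑_{d ≤ x} μ² g(d) log d`. [folklore] -/
def Dterm (x : ℝ) : ℝ :=
  ∑ p ∈ (Icc 1 ⌊x⌋₊).filter Nat.Prime, wterm γ p * (Gcop γ p (x / p) - Gcop γ p (x / p / p))

/-- Admissibility of `γ` at primes: `0 ≤ γ(p) < p` (a consequence of `(Ω₁)`). This is a hypothesis
PREDICATE on `γ` (type `(ℕ → ℝ) → Prop`, the binder written explicitly), not a closed named fact: it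
fails e.g. for `γ(p) = p` (`not_adm_natCast`) and is supplied by `adm_of_hypOmega1` under `(Ω₁)`.
[folklore] -/
def Adm (γ : ℕ → ℝ) : Prop := ∀ p : ℕ, p.Prime → 0 ≤ γ p ∧ γ p < p

variable {γ}

/-- `Adm` is a genuine hypothesis: it fails for `γ(p) = p`, so there is no unconditional `Adm γ`
(and no `Adm_holds`). [folklore] -/
theorem not_adm_natCast : ¬ Adm (fun p : ℕ => (p : ℝ)) := fun h =>
  lt_irrefl _ (h 2 Nat.prime_two).2

/-- `(Ω₁)` with `A₁ > 0` gives `0 ≤ γ(p) < p`. [folklore] -/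
theorem adm_of_hypOmega1 {A₁ : ℝ} (hA : 0 < A₁) (h : HypOmega1 γ A₁) : Adm γ := by
  intro p hp
  have hp0 : (0 : ℝ) < p := by exact_mod_cast hp.pos
  obtain ⟨h1, h2⟩ := h p hp
  refine ⟨?_, ?_⟩
  · have := mul_nonneg h1 hp0.le
    rwa [div_mul_cancel₀ _ hp0.ne'] at this
  · have : γ p / p < 1 := lt_of_le_of_lt h2 (by have := one_div_pos.2 hA; linarith)
    rwa [div_lt_one hp0] at this

/-- `γ(p) ≥ 0`. [folklore] -/
theorem Adm.gamma_nonneg (h : Adm γ) {p : ℕ} (hp : p.Prime) : 0 ≤ γ p := (h p hp).1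

/-- `p − γ(p) > 0`. [folklore] -/
theorem Adm.sub_pos (h : Adm γ) {p : ℕ} (hp : p.Prime) : 0 < (p : ℝ) - γ p := by
  have := (h p hp).2; linarith

/-- `g(p) ≥ 0`. [folklore] -/
theorem Adm.g_prime_nonneg (h : Adm γ) {p : ℕ} (hp : p.Prime) : 0 ≤ g γ p := by
  rw [g_prime γ hp]; exact div_nonneg (h.gamma_nonneg hp) (h.sub_pos hp).le

/-- `g(d) ≥ 0`. [folklore] -/
theorem Adm.g_nonneg (h : Adm γ) (d : ℕ) : 0 ≤ g γ d := by
  unfold g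
  exact Finset.prod_nonneg fun p hp =>
    div_nonneg (h.gamma_nonneg (Nat.prime_of_mem_primeFactors hp))
      (h.sub_pos (Nat.prime_of_mem_primeFactors hp)).le

/-- `a(d) = μ²(d) g(d) ≥ 0`. [folklore] -/
theorem Adm.wt_nonneg (h : Adm γ) (d : ℕ) : 0 ≤ wt γ d :=
  mul_nonneg (sq_nonneg _) (h.g_nonneg d)

/-- `γ(p)/p = g(p)/(1 + g(p))`, in the form `g(p) − γ(p)/p = g(p) · γ(p)/p`. [folklore] -/
theorem Adm.g_sub_div (h : Adm γ) {p : ℕ} (hp : p.Prime) :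
    g γ p - γ p / p = g γ p * (γ p / p) := by
  rw [g_prime γ hp]
  have hp0 : (p : ℝ) ≠ 0 := by exact_mod_cast hp.ne_zero
  have hs : (p : ℝ) - γ p ≠ 0 := (h.sub_pos hp).ne'
  field_simp
  ring

/-- `(1 − γ(p)/p)⁻¹ = 1 + g(p)`. [folklore] -/
theorem Adm.one_sub_div_inv (h : Adm γ) {p : ℕ} (hp : p.Prime) :
    (1 - γ p / p)⁻¹ = 1 + g γ p := by
  rw [g_prime γ hp]
  have hp0 : (p : ℝ) ≠ 0 := by exact_mod_cast hp.ne_zero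
  have hs : (p : ℝ) - γ p ≠ 0 := (h.sub_pos hp).ne'
  field_simp
  ring

/-! ### Multiplicativity at a prime -/

/-- `a(d) = 0` unless `d` is squarefree. [folklore] -/
theorem wt_eq_zero_of_not_squarefree {d : ℕ} (hd : ¬Squarefree d) : wt γ d = 0 := by
  rw [wt, ArithmeticFunction.moebius_eq_zero_of_not_squarefree hd]; simp

/-- `a(1) = 1`. [folklore] -/
theorem wt_one : wt γ 1 = 1 := by simp [wt, g_one]

/-- `a(pm) = g(p) a(m)` if `p ∤ m`, and `a(pm) = 0` if `p ∣ m`. [folklore] -/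
theorem wt_prime_mul {p m : ℕ} (hp : p.Prime) (hm : m ≠ 0) :
    wt γ (p * m) = if p ∣ m then 0 else g γ p * wt γ m := by
  split_ifs with hpm
  · apply wt_eq_zero_of_not_squarefree
    intro hsq
    obtain ⟨k, rfl⟩ := hpm
    have : p * p ∣ p * (p * k) := ⟨k, by ring⟩
    exact hp.not_isUnit (hsq p this)
  · have hcop : Nat.Coprime p m := (Nat.Prime.coprime_iff_not_dvd hp).2 hpm
    rw [wt, wt, g_mul_of_coprime γ hcop, ArithmeticFunction.isMultiplicative_moebius.map_mul_of_coprime hcop,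
      ArithmeticFunction.moebius_apply_prime hp]
    push_cast
    ring

/-- `{d ≤ N : p ∣ d} = p · {m ≤ N/p}`. [folklore] -/
theorem filter_dvd_Icc_eq_image {p : ℕ} (hp : 0 < p) (N : ℕ) :
    (Icc 1 N).filter (fun d => p ∣ d) = (Icc 1 (N / p)).image (fun m => p * m) := by
  ext d
  simp only [Finset.mem_filter, Finset.mem_Icc, Finset.mem_image]
  constructor
  · rintro ⟨⟨h1, h2⟩, k, rfl⟩
    refine ⟨k, ⟨?_, ?_⟩, rfl⟩
    · rcases Nat.eq_zero_or_pos k with hk | hk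
      · subst hk; simp at h1
      · exact hk
    · exact (Nat.le_div_iff_mul_le hp).2 (by rw [mul_comm]; exact h2)
  · rintro ⟨m, ⟨h1, h2⟩, rfl⟩
    refine ⟨⟨?_, ?_⟩, dvd_mul_right p m⟩
    · exact Nat.one_le_iff_ne_zero.2 (Nat.mul_ne_zero hp.ne' (by omega))
    · have := (Nat.le_div_iff_mul_le hp).1 h2
      rw [mul_comm]; exact this

/-- `∑_{d ≤ x, p ∣ d} a(d) = g(p) G_p(x/p)`. [folklore] -/
theorem sum_filter_dvd_eq {p : ℕ} (hp : p.Prime) (x : ℝ) :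
    ∑ d ∈ (Icc 1 ⌊x⌋₊).filter (fun d => p ∣ d), wt γ d = g γ p * Gcop γ p (x / p) := by
  rw [filter_dvd_Icc_eq_image hp.pos, Finset.sum_image]
  · rw [Gcop, Nat.floor_div_natCast, Finset.sum_filter, Finset.mul_sum]
    refine Finset.sum_congr rfl fun m hm => ?_
    have hm0 : m ≠ 0 := by have := (Finset.mem_Icc.1 hm).1; omega
    rw [wt_prime_mul hp hm0]
    split_ifs <;> simp
  · intro a _ b _ h
    exact Nat.eq_of_mul_eq_mul_left hp.pos h

/-- `G(x) = G_p(x) + g(p) G_p(x/p)`. [folklore] -/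
theorem Gs_eq_Gcop_add {p : ℕ} (hp : p.Prime) (x : ℝ) :
    Gs γ x = Gcop γ p x + g γ p * Gcop γ p (x / p) := by
  rw [Gs, ← sum_filter_dvd_eq hp, Gcop, Finset.sum_filter_not_add_sum_filter]

/-- For squarefree `d ≥ 1`: `log d = ∑_{p ∣ d} log p`; in general `a(d) log d = ∑_{p ∣ d} a(d) log p`. [folklore] -/
theorem wt_mul_log_eq_sum (d : ℕ) :
    wt γ d * Real.log d = ∑ p ∈ d.primeFactors, wt γ d * Real.log p := by
  by_cases hsq : Squarefree d
  · rw [← Finset.mul_sum]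
    congr 1
    conv_lhs => rw [← Nat.prod_primeFactors_of_squarefree hsq]
    push_cast
    rw [Real.log_prod]
    intro p hp
    exact_mod_cast (Nat.prime_of_mem_primeFactors hp).ne_zero
  · simp [wt_eq_zero_of_not_squarefree hsq]

/-- **Chebyshev-type identity**: `∑_{d ≤ x} a(d) log d = ∑_{p ≤ x} g(p) log p · G_p(x/p)`. [folklore] -/
theorem sum_wt_mul_log_eq (x : ℝ) :
    ∑ d ∈ Icc 1 ⌊x⌋₊, wt γ d * Real.log d =
      ∑ p ∈ (Icc 1 ⌊x⌋₊).filter Nat.Prime, g γ p * Real.log p * Gcop γ p (x / p) := by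
  have h1 : ∀ d ∈ Icc 1 ⌊x⌋₊, wt γ d * Real.log d =
      ∑ p ∈ (Icc 1 ⌊x⌋₊).filter Nat.Prime, if p ∣ d then wt γ d * Real.log p else 0 := by
    intro d hd
    rw [wt_mul_log_eq_sum, ← Finset.sum_filter]
    refine Finset.sum_congr ?_ fun _ _ => rfl
    ext p
    simp only [Nat.mem_primeFactors, Finset.mem_filter, Finset.mem_Icc]
    obtain ⟨hd1, hdN⟩ := Finset.mem_Icc.1 hd
    constructor
    · rintro ⟨hpp, hpd, -⟩
      exact ⟨⟨⟨hpp.one_lt.le, (Nat.le_of_dvd (by omega) hpd).trans hdN⟩, hpp⟩, hpd⟩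
    · rintro ⟨⟨-, hpp⟩, hpd⟩
      exact ⟨hpp, hpd, by omega⟩
  rw [Finset.sum_congr rfl h1, Finset.sum_comm]
  refine Finset.sum_congr rfl fun p hp => ?_
  have hpp : p.Prime := (Finset.mem_filter.1 hp).2
  rw [← Finset.sum_filter, ← Finset.sum_mul, sum_filter_dvd_eq hpp]
  ring

/-- The hyperbola-type swap `∑_{p ≤ N} f(p) ∑_{m ≤ N/p} h(m) = ∑_{m ≤ N} h(m) ∑_{p ≤ N/m} f(p)`. [folklore] -/
theorem sum_mul_sum_div_comm (f h : ℕ → ℝ) (N : ℕ) :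
    ∑ p ∈ Icc 1 N, f p * ∑ m ∈ Icc 1 (N / p), h m =
      ∑ m ∈ Icc 1 N, h m * ∑ p ∈ Icc 1 (N / m), f p := by
  have key : ∀ (u v : ℕ → ℝ), ∑ p ∈ Icc 1 N, u p * ∑ m ∈ Icc 1 (N / p), v m =
      ∑ p ∈ Icc 1 N, ∑ m ∈ Icc 1 N, if p * m ≤ N then u p * v m else 0 := by
    intro u v
    refine Finset.sum_congr rfl fun p hp => ?_
    have hp1 : 0 < p := (Finset.mem_Icc.1 hp).1
    rw [Finset.mul_sum, ← Finset.sum_filter]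
    refine Finset.sum_congr ?_ fun _ _ => rfl
    ext m
    simp only [Finset.mem_Icc, Finset.mem_filter]
    constructor
    · rintro ⟨h1, h2⟩
      have h3 := (Nat.le_div_iff_mul_le hp1).1 h2
      refine ⟨⟨h1, ?_⟩, by rw [mul_comm]; exact h3⟩
      exact le_trans (Nat.le_mul_of_pos_left m hp1) (by rw [mul_comm]; exact h3)
    · rintro ⟨⟨h1, -⟩, h3⟩
      exact ⟨h1, (Nat.le_div_iff_mul_le hp1).2 (by rw [mul_comm]; exact h3)⟩
  rw [key f h, key h f, Finset.sum_comm]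
  refine Finset.sum_congr rfl fun m _ => Finset.sum_congr rfl fun p _ => ?_
  rw [mul_comm p m]
  split_ifs <;> ring

/-- `∑_{p ≤ x} (γ(p) log p/p) G(x/p) = ∑_{m ≤ x} a(m) θ_γ(x/m)`. [folklore] -/
theorem sum_gamma_mul_Gs_eq (x : ℝ) :
    ∑ p ∈ (Icc 1 ⌊x⌋₊).filter Nat.Prime, γ p * Real.log p / p * Gs γ (x / p) =
      ∑ m ∈ Icc 1 ⌊x⌋₊, wt γ m * theta γ (x / m) := by
  have hL : ∑ p ∈ (Icc 1 ⌊x⌋₊).filter Nat.Prime, γ p * Real.log p / p * Gs γ (x / p) =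
      ∑ p ∈ Icc 1 ⌊x⌋₊, (if p.Prime then γ p * Real.log p / p else 0) *
        ∑ m ∈ Icc 1 (⌊x⌋₊ / p), wt γ m := by
    rw [Finset.sum_filter]
    refine Finset.sum_congr rfl fun p _ => ?_
    rw [Gs, Nat.floor_div_natCast]
    split_ifs <;> simp
  have hR : ∑ m ∈ Icc 1 ⌊x⌋₊, wt γ m * theta γ (x / m) =
      ∑ m ∈ Icc 1 ⌊x⌋₊, wt γ m * ∑ p ∈ Icc 1 (⌊x⌋₊ / m),
        (if p.Prime then γ p * Real.log p / p else 0) := by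
    refine Finset.sum_congr rfl fun m _ => ?_
    rw [theta, Nat.floor_div_natCast, Finset.sum_filter]
  rw [hL, hR, sum_mul_sum_div_comm]

/-- **The decomposition** `∑_{d ≤ x} a(d) log d = ∑_{m ≤ x} a(m) θ_γ(x/m) + D(x)`. [folklore] -/
theorem sum_wt_mul_log_eq_main_add_D (h : Adm γ) (x : ℝ) :
    ∑ d ∈ Icc 1 ⌊x⌋₊, wt γ d * Real.log d =
      ∑ m ∈ Icc 1 ⌊x⌋₊, wt γ m * theta γ (x / m) + Dterm γ x := by
  rw [sum_wt_mul_log_eq, ← sum_gamma_mul_Gs_eq, Dterm, ← Finset.sum_add_distrib]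
  refine Finset.sum_congr rfl fun p hp => ?_
  have hpp : p.Prime := (Finset.mem_filter.1 hp).2
  rw [Gs_eq_Gcop_add hpp (x / p), wterm]
  have := h.g_sub_div hpp
  linear_combination (Real.log p * Gcop γ p (x / p)) * this


/-! ### Bounds from `(Ω₁)`, `(Ω₂)` -/

/-- `g(p) ≤ A₁ γ(p)/p` (from `(Ω₁)`: `p − γ(p) ≥ p/A₁`). [cite: GoldstonEtAl2008, §2 display (2.2)] -/
theorem g_prime_le {A₁ : ℝ} (hA : 0 < A₁) (h1 : HypOmega1 γ A₁) {p : ℕ} (hp : p.Prime) :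
    g γ p ≤ A₁ * (γ p / p) := by
  have hadm := adm_of_hypOmega1 hA h1
  have hp0 : (0 : ℝ) < p := by exact_mod_cast hp.pos
  obtain ⟨h0, hle⟩ := h1 p hp
  have hγ : 0 ≤ γ p := hadm.gamma_nonneg hp
  -- `p − γ p ≥ p / A₁`
  have hsub : (p : ℝ) / A₁ ≤ p - γ p := by
    have : γ p ≤ (1 - 1 / A₁) * p := by
      rwa [div_le_iff₀ hp0] at hle
    have e : (1 - 1 / A₁) * (p : ℝ) = p - p / A₁ := by field_simp
    linarith
  rw [g_prime γ hp]
  calc γ p / (p - γ p) ≤ γ p / (p / A₁) :=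
        div_le_div_of_nonneg_left hγ (div_pos hp0 hA) hsub
    _ = A₁ * (γ p / p) := by field_simp

/-- `ω₂`-sum over the single prime `p`: `omega2Sum γ p (p+1) = γ(p) log p/p`. [folklore] -/
theorem omega2Sum_prime (γ : ℕ → ℝ) {p : ℕ} (hp : p.Prime) :
    omega2Sum γ p ((p : ℝ) + 1) = γ p * Real.log p / p := by
  unfold omega2Sum
  have h1 : ⌈(p : ℝ)⌉₊ = p := Nat.ceil_natCast p
  have h2 : ⌈(p : ℝ) + 1⌉₊ = p + 1 := by
    have : (p : ℝ) + 1 = ((p + 1 : ℕ) : ℝ) := by push_cast; ring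
    rw [this, Nat.ceil_natCast]
  rw [h1, h2, Nat.Ico_succ_singleton, Finset.filter_singleton, if_pos hp, Finset.sum_singleton]

/-- A single prime: `γ(p) log p / p ≤ A₂ + 1/2` (from `(Ω₂)` on `[p, p+1)`). [cite: GoldstonEtAl2008, §2 display (2.3)] -/
theorem gamma_log_div_le {A₂ L : ℝ} (h2 : HypOmega2 γ 1 A₂ L) {p : ℕ} (hp : p.Prime) :
    γ p * Real.log p / p ≤ A₂ + 1 / 2 := by
  have hp2 : (2 : ℝ) ≤ p := by exact_mod_cast hp.two_le
  have hp0 : (0 : ℝ) < p := by linarith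
  have h := (h2 p (p + 1) hp2 (by linarith)).2
  rw [omega2Sum_prime γ hp, one_mul] at h
  have hlog : Real.log (((p : ℝ) + 1) / p) ≤ 1 / 2 := by
    have e : ((p : ℝ) + 1) / p = 1 + 1 / p := by field_simp
    rw [e]
    calc Real.log (1 + 1 / p) ≤ (1 + 1 / p) - 1 := Real.log_le_sub_one_of_pos (by positivity)
      _ = 1 / p := by ring
      _ ≤ 1 / 2 := by gcongr
  linarith

/-- The window summand is nonnegative. [folklore] -/
theorem wterm_nonneg (h : Adm γ) {p : ℕ} (hp : p.Prime) : 0 ≤ wterm γ p := by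
  unfold wterm
  have := h.gamma_nonneg hp
  have := h.g_prime_nonneg hp
  have : 0 ≤ Real.log p := Real.log_nonneg (by exact_mod_cast hp.one_lt.le)
  positivity

/-- `γ(p) log p / p ≥ 0`. [folklore] -/
theorem gamma_log_div_nonneg (h : Adm γ) {p : ℕ} (hp : p.Prime) : 0 ≤ γ p * Real.log p / p := by
  have := h.gamma_nonneg hp
  have : 0 ≤ Real.log p := Real.log_nonneg (by exact_mod_cast hp.one_lt.le)
  positivity

/-- Every window summand is `≤ (A₂ + 1/2) A₁`. [folklore] -/
theorem wterm_le {A₁ A₂ L : ℝ} (hA : 0 < A₁) (h1 : HypOmega1 γ A₁) (h2 : HypOmega2 γ 1 A₂ L)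
    {p : ℕ} (hp : p.Prime) : wterm γ p ≤ (A₂ + 1 / 2) * A₁ := by
  have hadm := adm_of_hypOmega1 hA h1
  have hp0 : (0 : ℝ) < p := by exact_mod_cast hp.pos
  have hg : g γ p ≤ A₁ := by
    refine (g_prime_le hA h1 hp).trans ?_
    have : γ p / p ≤ 1 := by rw [div_le_one hp0]; exact (hadm p hp).2.le
    calc A₁ * (γ p / p) ≤ A₁ * 1 := by gcongr
      _ = A₁ := mul_one _
  unfold wterm
  exact mul_le_mul (gamma_log_div_le h2 hp) hg (hadm.g_prime_nonneg hp) (by linarith [(h2 2 2 le_rfl le_rfl).2, (h2 2 2 le_rfl le_rfl).1, gamma_log_div_nonneg hadm hp, gamma_log_div_le h2 hp])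

/-- A window summand with `p² > y ≥ 4`: `≤ (γ(p) log p/p) · 2A₁(A₂ + 1/2)/log y`. [folklore] -/
theorem wterm_le_of_sq {A₁ A₂ L : ℝ} (hA : 0 < A₁) (h1 : HypOmega1 γ A₁) (h2 : HypOmega2 γ 1 A₂ L)
    {y : ℝ} (hy : 4 ≤ y) {p : ℕ} (hp : p.Prime) (hpy : y < (p : ℝ) ^ 2) :
    wterm γ p ≤ γ p * Real.log p / p * (2 * A₁ * (A₂ + 1 / 2) / Real.log y) := by
  have hadm := adm_of_hypOmega1 hA h1
  have hp0 : (0 : ℝ) < p := by exact_mod_cast hp.pos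
  have hy0 : 0 < y := by linarith
  have hlogy : 0 < Real.log y := Real.log_pos (by linarith)
  -- `log p > log y / 2`
  have hlogp : Real.log y / 2 < Real.log p := by
    have : Real.log y < Real.log ((p : ℝ) ^ 2) := Real.log_lt_log hy0 hpy
    rw [Real.log_pow] at this
    push_cast at this
    linarith
  have hlogp0 : 0 < Real.log p := by linarith
  have hγp : γ p / p ≤ (A₂ + 1 / 2) / Real.log p := by
    rw [le_div_iff₀ hlogp0]
    have := gamma_log_div_le h2 hp
    calc γ p / p * Real.log p = γ p * Real.log p / p := by ring
      _ ≤ A₂ + 1 / 2 := this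
  have hA2 : 0 ≤ A₂ + 1 / 2 := by
    have := gamma_log_div_le h2 hp
    have := gamma_log_div_nonneg hadm hp
    linarith
  have hg : g γ p ≤ 2 * A₁ * (A₂ + 1 / 2) / Real.log y := by
    refine (g_prime_le hA h1 hp).trans ?_
    calc A₁ * (γ p / p) ≤ A₁ * ((A₂ + 1 / 2) / Real.log p) := by gcongr
      _ ≤ A₁ * ((A₂ + 1 / 2) / (Real.log y / 2)) := by
          gcongr
      _ = 2 * A₁ * (A₂ + 1 / 2) / Real.log y := by field_simp
  unfold wterm
  exact mul_le_mul_of_nonneg_left hg (gamma_log_div_nonneg hadm hp)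

/-- The window sum `W(y) = ∑_{√y < p ≤ y} (γ(p) log p/p) g(p)`. [folklore] -/
def Wwin (γ : ℕ → ℝ) (y : ℝ) : ℝ :=
  ∑ p ∈ ((Icc 1 ⌊y⌋₊).filter Nat.Prime).filter (fun p : ℕ => y < ((p : ℕ) : ℝ) ^ 2), wterm γ p

/-- The constant `C₁(A₁, A₂) = A₁ (A₂ + 1/2)(3 + 2A₂)` bounding every window sum. [folklore] -/
def C1 (A₁ A₂ : ℝ) : ℝ := A₁ * (A₂ + 1 / 2) * (3 + 2 * A₂)

/-- The empty window: `ω₂(w, w) = 0`. [folklore] -/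
theorem omega2Sum_self (γ : ℕ → ℝ) (w : ℝ) : omega2Sum γ w w = 0 := by
  unfold omega2Sum; simp

/-- `(Ω₂)` at `w = z = 2` gives `A₂ ≥ 0`. [folklore] -/
theorem A2_nonneg {A₂ L : ℝ} (h2 : HypOmega2 γ 1 A₂ L) : 0 ≤ A₂ := by
  have := (h2 2 2 le_rfl le_rfl).2
  rwa [omega2Sum_self, div_self (by norm_num : (2 : ℝ) ≠ 0), Real.log_one, mul_zero,
    sub_zero] at this

/-- `(Ω₂)` at `w = z = 2` gives `L ≥ 0`. [folklore] -/
theorem L_nonneg {A₂ L : ℝ} (h2 : HypOmega2 γ 1 A₂ L) : 0 ≤ L := by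
  have := (h2 2 2 le_rfl le_rfl).1
  rw [omega2Sum_self, div_self (by norm_num : (2 : ℝ) ≠ 0), Real.log_one, mul_zero,
    sub_zero] at this
  linarith

/-- `C₁ ≥ 0`. [folklore] -/
theorem C1_nonneg {A₁ A₂ : ℝ} (hA : 0 < A₁) (hA2 : 0 ≤ A₂) : 0 ≤ C1 A₁ A₂ := by
  unfold C1; positivity

/-- `log 4 ≥ 1`. [folklore] -/
theorem one_le_log_four : (1 : ℝ) ≤ Real.log 4 := by
  have : Real.log 4 = 2 * Real.log 2 := by
    rw [show (4 : ℝ) = 2 ^ 2 by norm_num, Real.log_pow]; push_cast; ring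
  rw [this]
  have := Real.log_two_gt_d9
  linarith

/-- **Window bound**: `W(y) ≤ C₁` for all real `y`. For `y ≥ 4` this is `(Ω₂)` on `[√y, y]`
(budget `½ log y + O(1)`) against `g(p) ≪ 1/log y` there; for `y < 4` at most the primes `≤ 3`
occur. [folklore] -/
theorem Wwin_le {A₁ A₂ L : ℝ} (hA : 0 < A₁) (h1 : HypOmega1 γ A₁) (h2 : HypOmega2 γ 1 A₂ L)
    (y : ℝ) : Wwin γ y ≤ C1 A₁ A₂ := by
  have hadm := adm_of_hypOmega1 hA h1
  have hA2 := A2_nonneg h2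
  set S := ((Icc 1 ⌊y⌋₊).filter Nat.Prime).filter (fun p : ℕ => y < ((p : ℕ) : ℝ) ^ 2) with hS
  have hSprime : ∀ p ∈ S, p.Prime := fun p hp =>
    (Finset.mem_filter.1 (Finset.mem_filter.1 hp).1).2
  by_cases hy : y < 4
  · -- at most the integers `1, 2, 3` occur
    have hfl : ⌊y⌋₊ ≤ 3 := by
      rcases lt_or_ge y 0 with hy0 | hy0
      · rw [Nat.floor_of_nonpos hy0.le]; norm_num
      · exact Nat.le_of_lt_succ ((Nat.floor_lt hy0).2 (by norm_num; exact hy))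
    have hcard : S.card ≤ 3 := by
      calc S.card ≤ ((Icc 1 ⌊y⌋₊).filter Nat.Prime).card := Finset.card_filter_le _ _
        _ ≤ (Icc 1 ⌊y⌋₊).card := Finset.card_filter_le _ _
        _ = ⌊y⌋₊ := by simp
        _ ≤ 3 := hfl
    calc Wwin γ y = ∑ p ∈ S, wterm γ p := rfl
      _ ≤ ∑ p ∈ S, (A₂ + 1 / 2) * A₁ :=
          Finset.sum_le_sum fun p hp => wterm_le hA h1 h2 (hSprime p hp)
      _ = S.card * ((A₂ + 1 / 2) * A₁) := by rw [Finset.sum_const, nsmul_eq_mul]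
      _ ≤ 3 * ((A₂ + 1 / 2) * A₁) := by gcongr; exact_mod_cast hcard
      _ ≤ C1 A₁ A₂ := by
          unfold C1
          nlinarith [mul_nonneg (mul_nonneg hA.le (by linarith : (0:ℝ) ≤ A₂ + 1/2)) hA2]
  · have hy : 4 ≤ y := not_lt.1 hy
    have hy0 : 0 < y := by linarith
    have hy1 : 1 ≤ y := by linarith
    have hlogy : 1 ≤ Real.log y :=
      one_le_log_four.trans (Real.log_le_log (by norm_num) hy)
    have hlogy0 : 0 < Real.log y := by linarith
    -- compare with `(Ω₂)` on `[√y, ⌊y⌋ + 1)`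
    set z : ℝ := ((⌊y⌋₊ + 1 : ℕ) : ℝ) with hz
    have hsq2 : 2 ≤ Real.sqrt y := by
      rw [show (2 : ℝ) = Real.sqrt 4 by
        rw [show (4 : ℝ) = 2 ^ 2 by norm_num, Real.sqrt_sq (by norm_num)]]
      exact Real.sqrt_le_sqrt hy
    have hsqy : Real.sqrt y ≤ y := by
      rw [Real.sqrt_le_iff]; exact ⟨hy0.le, by nlinarith⟩
    have hyz : y ≤ z := by
      rw [hz]; push_cast; exact (Nat.lt_floor_add_one y).le
    have hz2y : z ≤ 2 * y := by
      rw [hz]; push_cast; linarith [Nat.floor_le hy0.le]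
    have hΩ := (h2 (Real.sqrt y) z hsq2 (hsqy.trans hyz)).2
    rw [one_mul] at hΩ
    have hlogz : Real.log (z / Real.sqrt y) ≤ Real.log 2 + Real.log y / 2 := by
      rw [Real.log_div (by linarith) (by linarith), Real.log_sqrt hy0.le]
      have : Real.log z ≤ Real.log (2 * y) := Real.log_le_log (by linarith) hz2y
      rw [Real.log_mul (by norm_num) hy0.ne'] at this
      linarith
    have hsub : S ⊆ (Finset.Ico ⌈Real.sqrt y⌉₊ ⌈z⌉₊).filter Nat.Prime := by
      intro p hp
      have hp1 := Finset.mem_filter.1 hp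
      have hp2 := Finset.mem_filter.1 hp1.1
      have hpp : p.Prime := hp2.2
      have hpI := Finset.mem_Icc.1 hp2.1
      refine Finset.mem_filter.2 ⟨Finset.mem_Ico.2 ⟨?_, ?_⟩, hpp⟩
      · refine Nat.ceil_le.2 ?_
        have hp0 : (0 : ℝ) < p := by exact_mod_cast hpp.pos
        exact ((Real.sqrt_lt' hp0).2 hp1.2).le
      · rw [hz, Nat.ceil_natCast]; exact Nat.lt_succ_of_le hpI.2
    have hsumle : ∑ p ∈ S, γ p * Real.log p / p ≤ omega2Sum γ (Real.sqrt y) z := by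
      unfold omega2Sum
      exact Finset.sum_le_sum_of_subset_of_nonneg hsub fun p hp _ =>
        gamma_log_div_nonneg hadm (Finset.mem_filter.1 hp).2
    have hsum0 : 0 ≤ ∑ p ∈ S, γ p * Real.log p / p :=
      Finset.sum_nonneg fun p hp => gamma_log_div_nonneg hadm (hSprime p hp)
    set M : ℝ := 2 * A₁ * (A₂ + 1 / 2) / Real.log y with hM
    have hM0 : 0 ≤ M := by rw [hM]; positivity
    calc Wwin γ y = ∑ p ∈ S, wterm γ p := rfl
      _ ≤ ∑ p ∈ S, γ p * Real.log p / p * M :=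
          Finset.sum_le_sum fun p hp =>
            wterm_le_of_sq hA h1 h2 hy (hSprime p hp) (Finset.mem_filter.1 hp).2
      _ = (∑ p ∈ S, γ p * Real.log p / p) * M := by rw [Finset.sum_mul]
      _ ≤ (A₂ + (Real.log 2 + Real.log y / 2)) * M := by
          refine mul_le_mul_of_nonneg_right ?_ hM0
          linarith
      _ = A₁ * (A₂ + 1 / 2) + 2 * A₁ * (A₂ + 1 / 2) * (A₂ + Real.log 2) / Real.log y := by
          rw [hM]; field_simp; ring
      _ ≤ A₁ * (A₂ + 1 / 2) + 2 * A₁ * (A₂ + 1 / 2) * (A₂ + 1) := by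
          have hl2 : Real.log 2 ≤ 1 := by have := Real.log_two_lt_d9; linarith
          have hnum : 0 ≤ 2 * A₁ * (A₂ + 1 / 2) * (A₂ + Real.log 2) := by
            have : 0 ≤ A₂ + Real.log 2 := by have := Real.log_two_gt_d9; linarith
            positivity
          calc A₁ * (A₂ + 1 / 2) + 2 * A₁ * (A₂ + 1 / 2) * (A₂ + Real.log 2) / Real.log y
              ≤ A₁ * (A₂ + 1 / 2) + 2 * A₁ * (A₂ + 1 / 2) * (A₂ + Real.log 2) / 1 := by
                gcongr
            _ ≤ A₁ * (A₂ + 1 / 2) + 2 * A₁ * (A₂ + 1 / 2) * (A₂ + 1) := by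
                rw [div_one]
                have : 0 ≤ 2 * A₁ * (A₂ + 1 / 2) := by positivity
                nlinarith
      _ = C1 A₁ A₂ := by unfold C1; ring

/-! ### The second-order term `D(x) ≤ C₁ G(x)` -/

/-- `[1, a] = [1, b] ∪ (b, a]` for `b ≤ a`. [folklore] -/
theorem Icc_one_eq_union {a b : ℕ} (h : b ≤ a) : Icc 1 a = Icc 1 b ∪ Ioc b a := by
  ext d; simp only [Finset.mem_Icc, Finset.mem_union, Finset.mem_Ioc]; omega

/-- `[1, b]` and `(b, a]` are disjoint. [folklore] -/
theorem disjoint_Icc_one_Ioc (a b : ℕ) : Disjoint (Icc 1 b) (Ioc b a) := by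
  rw [Finset.disjoint_left]
  intro d h1 h2
  simp only [Finset.mem_Icc, Finset.mem_Ioc] at h1 h2
  omega

/-- `G_p(x) − G_p(x') = ∑_{x' < d ≤ x, p ∤ d} a(d)` for `⌊x'⌋ ≤ ⌊x⌋`. [folklore] -/
theorem Gcop_sub_eq (p : ℕ) {x x' : ℝ} (h : ⌊x'⌋₊ ≤ ⌊x⌋₊) :
    Gcop γ p x - Gcop γ p x' = ∑ d ∈ (Ioc ⌊x'⌋₊ ⌊x⌋₊).filter (fun d => ¬p ∣ d), wt γ d := by
  rw [Gcop, Gcop, Icc_one_eq_union h, Finset.filter_union, Finset.sum_union]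
  · ring
  · exact Finset.disjoint_filter_filter (disjoint_Icc_one_Ioc _ _)

/-- `⌊x/p²⌋ ≤ ⌊x/p⌋`. [folklore] -/
theorem floor_div_div_le {x : ℝ} (hx : 0 ≤ x) {p : ℕ} (hp : 1 ≤ p) :
    ⌊x / p / p⌋₊ ≤ ⌊x / p⌋₊ :=
  Nat.floor_mono (div_le_self (by positivity) (by exact_mod_cast hp))

/-- `⌊x/p⌋ ≤ ⌊x⌋`. [folklore] -/
theorem floor_div_le {x : ℝ} (hx : 0 ≤ x) {p : ℕ} (hp : 1 ≤ p) : ⌊x / p⌋₊ ≤ ⌊x⌋₊ :=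
  Nat.floor_mono (div_le_self hx (by exact_mod_cast hp))

/-- `D(x) ≥ 0`. [folklore] -/
theorem Dterm_nonneg (h : Adm γ) {x : ℝ} (hx : 0 ≤ x) : 0 ≤ Dterm γ x := by
  unfold Dterm
  refine Finset.sum_nonneg fun p hp => ?_
  have hpp : p.Prime := (Finset.mem_filter.1 hp).2
  refine mul_nonneg (wterm_nonneg h hpp) ?_
  rw [Gcop_sub_eq p (floor_div_div_le hx hpp.one_lt.le)]
  exact Finset.sum_nonneg fun d _ => h.wt_nonneg d

/-- The inner prime sum at a fixed `d` is a window sum: the primes `p` with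
`⌊x/p²⌋ < d ≤ ⌊x/p⌋` satisfy `√(x/d) < p ≤ x/d`. [folklore] -/
theorem sum_ite_wterm_le_Wwin (h : Adm γ) {x : ℝ} (hx : 0 ≤ x) {d : ℕ} (hd : 1 ≤ d) :
    ∑ p ∈ (Icc 1 ⌊x⌋₊).filter Nat.Prime,
        (if ⌊x / p / p⌋₊ < d ∧ d ≤ ⌊x / p⌋₊ then wterm γ p else 0) ≤ Wwin γ (x / d) := by
  rw [← Finset.sum_filter, Wwin]
  have hd0 : (0 : ℝ) < d := by exact_mod_cast hd
  refine Finset.sum_le_sum_of_subset_of_nonneg ?_ fun p hp _ =>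
    wterm_nonneg h (Finset.mem_filter.1 (Finset.mem_filter.1 hp).1).2
  intro p hp
  obtain ⟨hp1, hlt, hle⟩ := Finset.mem_filter.1 hp
  obtain ⟨hpI, hpp⟩ := Finset.mem_filter.1 hp1
  have hp0 : (0 : ℝ) < p := by exact_mod_cast hpp.pos
  -- `d ≤ ⌊x/p⌋` gives `p d ≤ x`
  have h1 : (d : ℝ) ≤ x / p := (Nat.le_floor_iff (by positivity)).1 hle
  have h1' : (p : ℝ) ≤ x / d := by
    rw [le_div_iff₀ hd0]; rw [le_div_iff₀ hp0] at h1; linarith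
  -- `⌊x/p²⌋ < d` gives `x < d p²`
  have h2 : x / p / p < d := Nat.lt_of_floor_lt hlt
  have h2' : x / d < (p : ℝ) ^ 2 := by
    rw [div_lt_iff₀ hd0]
    rw [div_div, div_lt_iff₀ (by positivity)] at h2
    nlinarith
  refine Finset.mem_filter.2 ⟨Finset.mem_filter.2 ⟨Finset.mem_Icc.2 ⟨hpp.one_lt.le, ?_⟩, hpp⟩, h2'⟩
  exact Nat.le_floor h1'

/-- **`D(x) ≤ C₁ G(x)`** (`x ≥ 0`). [folklore] -/
theorem Dterm_le {A₁ A₂ L : ℝ} (hA : 0 < A₁) (h1 : HypOmega1 γ A₁) (h2 : HypOmega2 γ 1 A₂ L)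
    {x : ℝ} (hx : 0 ≤ x) : Dterm γ x ≤ C1 A₁ A₂ * Gs γ x := by
  have hadm := adm_of_hypOmega1 hA h1
  set P := (Icc 1 ⌊x⌋₊).filter Nat.Prime with hP
  have hPp : ∀ p ∈ P, p.Prime := fun p hp => (Finset.mem_filter.1 hp).2
  -- step 1: drop the coprimality condition
  have step1 : Dterm γ x ≤ ∑ p ∈ P, wterm γ p * ∑ d ∈ Ioc ⌊x / p / p⌋₊ ⌊x / p⌋₊, wt γ d := by
    unfold Dterm
    refine Finset.sum_le_sum fun p hp => ?_
    have hpp := hPp p hp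
    rw [Gcop_sub_eq p (floor_div_div_le hx hpp.one_lt.le)]
    refine mul_le_mul_of_nonneg_left ?_ (wterm_nonneg hadm hpp)
    exact Finset.sum_le_sum_of_subset_of_nonneg (Finset.filter_subset _ _)
      fun d _ _ => hadm.wt_nonneg d
  -- step 2: indicator form and swap
  have step2 : ∑ p ∈ P, wterm γ p * ∑ d ∈ Ioc ⌊x / p / p⌋₊ ⌊x / p⌋₊, wt γ d =
      ∑ d ∈ Icc 1 ⌊x⌋₊, wt γ d * ∑ p ∈ P,
        (if ⌊x / p / p⌋₊ < d ∧ d ≤ ⌊x / p⌋₊ then wterm γ p else 0) := by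
    have hinner : ∀ p ∈ P, ∑ d ∈ Ioc ⌊x / p / p⌋₊ ⌊x / p⌋₊, wt γ d =
        ∑ d ∈ Icc 1 ⌊x⌋₊, if ⌊x / p / p⌋₊ < d ∧ d ≤ ⌊x / p⌋₊ then wt γ d else 0 := by
      intro p hp
      have hpp := hPp p hp
      rw [← Finset.sum_filter]
      refine Finset.sum_congr ?_ fun _ _ => rfl
      ext d
      simp only [Finset.mem_Ioc, Finset.mem_filter, Finset.mem_Icc]
      have := floor_div_le hx hpp.one_lt.le
      omega
    rw [Finset.sum_congr rfl fun p hp => by rw [hinner p hp]]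
    simp_rw [Finset.mul_sum]
    rw [Finset.sum_comm]
    refine Finset.sum_congr rfl fun d _ => ?_
    refine Finset.sum_congr rfl fun p _ => ?_
    split_ifs <;> ring
  -- step 3: window bound
  calc Dterm γ x ≤ _ := step1
    _ = _ := step2
    _ ≤ ∑ d ∈ Icc 1 ⌊x⌋₊, wt γ d * C1 A₁ A₂ := by
        refine Finset.sum_le_sum fun d hd => mul_le_mul_of_nonneg_left ?_ (hadm.wt_nonneg d)
        exact (sum_ite_wterm_le_Wwin hadm hx (Finset.mem_Icc.1 hd).1).trans (Wwin_le hA h1 h2 _)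
    _ = C1 A₁ A₂ * Gs γ x := by rw [Gs, Finset.mul_sum]; exact Finset.sum_congr rfl fun _ _ => by ring

/-! ### `θ_γ(y) = log y + O(L)` -/

/-- `θ_γ(y)` is the `ω₂`-sum on `[2, ⌊y⌋ + 1)`. [folklore] -/
theorem theta_eq_omega2Sum (y : ℝ) : theta γ y = omega2Sum γ 2 ((⌊y⌋₊ + 1 : ℕ) : ℝ) := by
  unfold theta omega2Sum
  rw [Nat.ceil_natCast, show ⌈(2 : ℝ)⌉₊ = 2 by norm_num]
  refine Finset.sum_congr ?_ fun _ _ => rfl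
  ext p
  simp only [Finset.mem_filter, Finset.mem_Icc, Finset.mem_Ico]
  constructor
  · rintro ⟨⟨-, h2⟩, hp⟩; exact ⟨⟨hp.two_le, Nat.lt_succ_of_le h2⟩, hp⟩
  · rintro ⟨⟨h1, h2⟩, hp⟩; exact ⟨⟨hp.one_lt.le, Nat.le_of_lt_succ h2⟩, hp⟩

/-- `|θ_γ(y) − log y| ≤ L + A₂ + 1` for `y ≥ 1` (from `(Ω₂)` on `[2, ⌊y⌋ + 1)`). [cite: GoldstonEtAl2008, §2 display (2.3)] -/
theorem abs_theta_sub_log_le {A₂ L : ℝ} (h2 : HypOmega2 γ 1 A₂ L) {y : ℝ} (hy : 1 ≤ y) :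
    |theta γ y - Real.log y| ≤ L + A₂ + 1 := by
  have hy0 : 0 < y := by linarith
  set z : ℝ := ((⌊y⌋₊ + 1 : ℕ) : ℝ) with hz
  have hfl1 : 1 ≤ ⌊y⌋₊ := Nat.le_floor (by simpa using hy)
  have hz2 : (2 : ℝ) ≤ z := by
    rw [hz]; push_cast; exact_mod_cast (by omega : 2 ≤ ⌊y⌋₊ + 1)
  have h := h2 2 z le_rfl hz2
  rw [← theta_eq_omega2Sum, one_mul] at h
  -- `log(z/2) ∈ [log y − log 2, log y]`
  have hzy : z ≤ 2 * y := by
    rw [hz]; push_cast; linarith [Nat.floor_le hy0.le]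
  have hyz : y < z := by rw [hz]; push_cast; exact Nat.lt_floor_add_one y
  have hl1 : Real.log (z / 2) ≤ Real.log y :=
    Real.log_le_log (by linarith) (by linarith)
  have hl2 : Real.log y - Real.log 2 ≤ Real.log (z / 2) := by
    rw [Real.log_div (by linarith) (by norm_num)]
    have := Real.log_le_log hy0 hyz.le
    linarith
  have hlog2 : Real.log 2 ≤ 1 := by have := Real.log_two_lt_d9; linarith
  have hA2 := A2_nonneg h2
  have hL := L_nonneg h2
  rw [abs_le]
  constructor <;> linarith [h.1, h.2]

/-! ### The key inequality `|G(x) log x − 2 T(x)| ≤ K G(x)` -/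

/-- The constant `K = L + A₂ + 1 + C₁(A₁, A₂)`. [folklore] -/
def Kc (A₁ A₂ L : ℝ) : ℝ := L + A₂ + 1 + C1 A₁ A₂

/-- **Key inequality**: `|G(x) log x − 2T(x)| ≤ K G(x)` for `x ≥ 1`, where
`T(x) = ∑_{d ≤ x} a(d) log(x/d)`: the identity `G log x = T + ∑ a(d) log d`, the decomposition
`∑ a(d) log d = ∑ a(m) θ_γ(x/m) + D`, `θ_γ = log + O(L)` and `0 ≤ D ≤ C₁ G`. [folklore] -/
theorem abs_Gs_mul_log_sub_le {A₁ A₂ L : ℝ} (hA : 0 < A₁) (h1 : HypOmega1 γ A₁)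
    (h2 : HypOmega2 γ 1 A₂ L) {x : ℝ} (hx : 1 ≤ x) :
    |Gs γ x * Real.log x - 2 * Ts γ x| ≤ Kc A₁ A₂ L * Gs γ x := by
  have hadm := adm_of_hypOmega1 hA h1
  have hx0 : 0 < x := by linarith
  -- `G log x = T + ∑ a(d) log d`
  have hsplit : Gs γ x * Real.log x = Ts γ x + ∑ d ∈ Icc 1 ⌊x⌋₊, wt γ d * Real.log d := by
    rw [Gs, Ts, Finset.sum_mul, ← Finset.sum_add_distrib]
    refine Finset.sum_congr rfl fun d hd => ?_
    have hd0 : (0 : ℝ) < d := by exact_mod_cast (Finset.mem_Icc.1 hd).1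
    rw [Real.log_div hx0.ne' hd0.ne']
    ring
  rw [hsplit, sum_wt_mul_log_eq_main_add_D hadm]
  have hT : Ts γ x = ∑ m ∈ Icc 1 ⌊x⌋₊, wt γ m * Real.log (x / m) := rfl
  have hmain : |∑ m ∈ Icc 1 ⌊x⌋₊, wt γ m * theta γ (x / m) - Ts γ x| ≤ (L + A₂ + 1) * Gs γ x := by
    rw [hT, ← Finset.sum_sub_distrib, Gs, Finset.mul_sum]
    refine (Finset.abs_sum_le_sum_abs _ _).trans (Finset.sum_le_sum fun m hm => ?_)
    have hm := Finset.mem_Icc.1 hm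
    have hm0 : (0 : ℝ) < m := by exact_mod_cast hm.1
    have hxm : 1 ≤ x / m := by
      rw [le_div_iff₀ hm0, one_mul]
      exact le_trans (by exact_mod_cast hm.2) (Nat.floor_le hx0.le)
    rw [← mul_sub, abs_mul, abs_of_nonneg (hadm.wt_nonneg m), mul_comm]
    exact mul_le_mul_of_nonneg_right (abs_theta_sub_log_le h2 hxm) (hadm.wt_nonneg m)
  have hD0 := Dterm_nonneg hadm hx0.le
  have hD1 := Dterm_le hA h1 h2 hx0.le
  have hG0 : 0 ≤ Gs γ x := Finset.sum_nonneg fun d _ => hadm.wt_nonneg d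
  rw [abs_le] at hmain ⊢
  unfold Kc
  constructor <;> nlinarith [hmain.1, hmain.2, C1_nonneg hA (A2_nonneg h2)]

/-! ### Quadratic fencing lemmas (the differential inequalities `(u ∓ K) T' ⋚ 2T`) -/

/-- If `T` is continuous with right derivative `G` and `(x − K) G(x) ≤ 2 T(x)` on `[u₀, u₁)`
(`K < u₀`, `T(u₀) > 0`), then `T(u)/(u − K)²` does not increase from `u₀` to `u₁`. [folklore] -/
theorem quad_fence_upper {T G : ℝ → ℝ} {K u₀ u₁ : ℝ} (hK : K < u₀) (hu : u₀ ≤ u₁)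
    (hT : ContinuousOn T (Set.Icc u₀ u₁))
    (hderiv : ∀ x ∈ Set.Ico u₀ u₁, HasDerivWithinAt T (G x) (Set.Ici x) x)
    (hineq : ∀ x ∈ Set.Ico u₀ u₁, (x - K) * G x ≤ 2 * T x) (hpos : 0 < T u₀) :
    T u₁ * (u₀ - K) ^ 2 ≤ T u₀ * (u₁ - K) ^ 2 := by
  have hK0 : 0 < u₀ - K := by linarith
  set M := T u₀ / (u₀ - K) ^ 2 with hM
  have hM0 : 0 < M := div_pos hpos (by positivity)
  have hstep : ∀ δ : ℝ, 0 < δ → T u₁ ≤ M * (u₁ - K) ^ 2 * Real.exp (δ * (u₁ - u₀)) := by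
    intro δ hδ
    set B : ℝ → ℝ := fun x => M * (x - K) ^ 2 * Real.exp (δ * (x - u₀)) with hB
    set B' : ℝ → ℝ := fun x => M * (2 * (x - K)) * Real.exp (δ * (x - u₀)) +
      M * (x - K) ^ 2 * (δ * Real.exp (δ * (x - u₀))) with hB'
    have hBd : ∀ x, HasDerivAt B (B' x) x := by
      intro x
      have h1 : HasDerivAt (fun x => M * (x - K) ^ 2) (M * (2 * (x - K))) x := by
        have := ((hasDerivAt_id' x).sub_const K).pow 2
        exact (this.const_mul M).congr_deriv (by norm_num)
      have h2 : HasDerivAt (fun x => Real.exp (δ * (x - u₀))) (δ * Real.exp (δ * (x - u₀))) x := by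
        have hin : HasDerivAt (fun x => δ * (x - u₀)) δ x :=
          (((hasDerivAt_id' x).sub_const u₀).const_mul δ).congr_deriv (by ring)
        exact hin.exp.congr_deriv (by ring)
      exact h1.mul h2
    have hres := image_le_of_deriv_right_lt_deriv_boundary hT hderiv (B := B) (B' := B')
      (le_of_eq (by
        simp only [hB]
        rw [sub_self, mul_zero, Real.exp_zero, mul_one, hM, div_mul_cancel₀ _ (by positivity)]))
      hBd ?_ (Set.right_mem_Icc.2 hu)
    · simpa [hB] using hres
    · intro x hx hTx
      have hxK : 0 < x - K := by linarith [hx.1]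
      have hTx' : T x = M * (x - K) ^ 2 * Real.exp (δ * (x - u₀)) := hTx
      have hex : 0 < Real.exp (δ * (x - u₀)) := Real.exp_pos _
      have h1 : G x ≤ M * (2 * (x - K)) * Real.exp (δ * (x - u₀)) := by
        have := hineq x hx
        rw [hTx'] at this
        -- divide by `x - K > 0`
        have : (x - K) * G x ≤ (x - K) * (M * (2 * (x - K)) * Real.exp (δ * (x - u₀))) := by
          nlinarith
        exact le_of_mul_le_mul_left this hxK
      have h2 : 0 < M * (x - K) ^ 2 * (δ * Real.exp (δ * (x - u₀))) := by positivity
      show G x < B' x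
      simp only [hB']
      linarith
  -- let `δ → 0+`
  have hlim : Tendsto (fun δ : ℝ => M * (u₁ - K) ^ 2 * Real.exp (δ * (u₁ - u₀))) (𝓝[>] 0)
      (𝓝 (M * (u₁ - K) ^ 2)) := by
    have hc : Continuous fun δ : ℝ => M * (u₁ - K) ^ 2 * Real.exp (δ * (u₁ - u₀)) := by
      fun_prop
    have := hc.tendsto 0
    simp only [zero_mul, Real.exp_zero, mul_one] at this
    exact this.mono_left nhdsWithin_le_nhds
  have hle : T u₁ ≤ M * (u₁ - K) ^ 2 :=
    ge_of_tendsto hlim (eventually_nhdsWithin_of_forall fun δ hδ => hstep δ hδ)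
  calc T u₁ * (u₀ - K) ^ 2 ≤ M * (u₁ - K) ^ 2 * (u₀ - K) ^ 2 := by
        exact mul_le_mul_of_nonneg_right hle (by positivity)
    _ = T u₀ * (u₁ - K) ^ 2 := by rw [hM]; field_simp

/-- If `T` is continuous with right derivative `G` and `2 T(x) ≤ (x + K) G(x)` on `[u₀, u₁)`
(`u₀ + K > 0`, `T(u₀) > 0`), then `T(u)/(u + K)²` does not decrease from `u₀` to `u₁`. [folklore] -/
theorem quad_fence_lower {T G : ℝ → ℝ} {K u₀ u₁ : ℝ} (hK : 0 < u₀ + K) (hu : u₀ ≤ u₁)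
    (hT : ContinuousOn T (Set.Icc u₀ u₁))
    (hderiv : ∀ x ∈ Set.Ico u₀ u₁, HasDerivWithinAt T (G x) (Set.Ici x) x)
    (hineq : ∀ x ∈ Set.Ico u₀ u₁, 2 * T x ≤ (x + K) * G x) (hpos : 0 < T u₀) :
    T u₀ * (u₁ + K) ^ 2 ≤ T u₁ * (u₀ + K) ^ 2 := by
  set M := T u₀ / (u₀ + K) ^ 2 with hM
  have hM0 : 0 < M := div_pos hpos (by positivity)
  have hstep : ∀ δ : ℝ, 0 < δ → M * (u₁ + K) ^ 2 * Real.exp (-(δ * (u₁ - u₀))) ≤ T u₁ := by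
    intro δ hδ
    set B : ℝ → ℝ := fun x => -(M * (x + K) ^ 2 * Real.exp (-(δ * (x - u₀)))) with hB
    set B' : ℝ → ℝ := fun x => -(M * (2 * (x + K)) * Real.exp (-(δ * (x - u₀))) +
      M * (x + K) ^ 2 * (-δ * Real.exp (-(δ * (x - u₀))))) with hB'
    have hBd : ∀ x, HasDerivAt B (B' x) x := by
      intro x
      have h1 : HasDerivAt (fun x => M * (x + K) ^ 2) (M * (2 * (x + K))) x := by
        have := ((hasDerivAt_id' x).add_const K).pow 2
        exact (this.const_mul M).congr_deriv (by norm_num)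
      have h2 : HasDerivAt (fun x => Real.exp (-(δ * (x - u₀)))) (-δ * Real.exp (-(δ * (x - u₀)))) x := by
        have hin : HasDerivAt (fun x => -(δ * (x - u₀))) (-δ) x :=
          ((((hasDerivAt_id' x).sub_const u₀).const_mul δ).neg).congr_deriv (by ring)
        exact hin.exp.congr_deriv (by ring)
      exact (h1.mul h2).neg
    have hTn : ContinuousOn (fun x => -T x) (Set.Icc u₀ u₁) := hT.neg
    have hderivn : ∀ x ∈ Set.Ico u₀ u₁, HasDerivWithinAt (fun x => -T x) (-G x) (Set.Ici x) x :=
      fun x hx => (hderiv x hx).neg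
    have hres := image_le_of_deriv_right_lt_deriv_boundary hTn hderivn (B := B) (B' := B')
      (le_of_eq (by
        simp only [hB]
        rw [sub_self, mul_zero, neg_zero, Real.exp_zero, mul_one, hM,
          div_mul_cancel₀ _ (by positivity)]))
      hBd ?_ (Set.right_mem_Icc.2 hu)
    · simp only [hB] at hres
      linarith
    · intro x hx hTx
      have hxK : 0 < x + K := by linarith [hx.1]
      have hex : 0 < Real.exp (-(δ * (x - u₀))) := Real.exp_pos _
      have hTx' : T x = M * (x + K) ^ 2 * Real.exp (-(δ * (x - u₀))) := by
        have : -T x = -(M * (x + K) ^ 2 * Real.exp (-(δ * (x - u₀)))) := hTx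
        linarith
      have h1 : M * (2 * (x + K)) * Real.exp (-(δ * (x - u₀))) ≤ G x := by
        have := hineq x hx
        rw [hTx'] at this
        have : (x + K) * (M * (2 * (x + K)) * Real.exp (-(δ * (x - u₀)))) ≤ (x + K) * G x := by
          nlinarith
        exact le_of_mul_le_mul_left this hxK
      have h2 : 0 < M * (x + K) ^ 2 * (δ * Real.exp (-(δ * (x - u₀)))) := by positivity
      show -G x < B' x
      simp only [hB']
      nlinarith
  have hlim : Tendsto (fun δ : ℝ => M * (u₁ + K) ^ 2 * Real.exp (-(δ * (u₁ - u₀)))) (𝓝[>] 0)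
      (𝓝 (M * (u₁ + K) ^ 2)) := by
    have hc : Continuous fun δ : ℝ => M * (u₁ + K) ^ 2 * Real.exp (-(δ * (u₁ - u₀))) := by
      fun_prop
    have := hc.tendsto 0
    simp only [zero_mul, neg_zero, Real.exp_zero, mul_one] at this
    exact this.mono_left nhdsWithin_le_nhds
  have hle : M * (u₁ + K) ^ 2 ≤ T u₁ :=
    le_of_tendsto hlim (eventually_nhdsWithin_of_forall fun δ hδ => hstep δ hδ)
  calc T u₀ * (u₁ + K) ^ 2 = M * (u₁ + K) ^ 2 * (u₀ + K) ^ 2 := by rw [hM]; field_simp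
    _ ≤ T u₁ * (u₀ + K) ^ 2 := mul_le_mul_of_nonneg_right hle (by positivity)

/-! ### Log-coordinates: `G̃(u) = G(eᵘ)`, `T̃(u) = T(eᵘ)` -/

/-- `G̃(u) = G(eᵘ)`. [folklore] -/
def Gt (γ : ℕ → ℝ) (u : ℝ) : ℝ := Gs γ (Real.exp u)

/-- `T̃(u) = T(eᵘ) = ∑_{d ≤ eᵘ} a(d) (u − log d)`. [folklore] -/
def Tt (γ : ℕ → ℝ) (u : ℝ) : ℝ := ∑ d ∈ Icc 1 ⌊Real.exp u⌋₊, wt γ d * (u - Real.log d)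

/-- `T̃(u) = T(eᵘ)`. [folklore] -/
theorem Tt_eq_Ts (u : ℝ) : Tt γ u = Ts γ (Real.exp u) := by
  unfold Tt Ts
  refine Finset.sum_congr rfl fun d hd => ?_
  have hd0 : (0 : ℝ) < d := by exact_mod_cast (Finset.mem_Icc.1 hd).1
  rw [Real.log_div (Real.exp_pos u).ne' hd0.ne', Real.log_exp]

/-- The key inequality in log-coordinates: `|u G̃(u) − 2 T̃(u)| ≤ K G̃(u)` for `u ≥ 0`. [folklore] -/
theorem abs_Gt_sub_le {A₁ A₂ L : ℝ} (hA : 0 < A₁) (h1 : HypOmega1 γ A₁)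
    (h2 : HypOmega2 γ 1 A₂ L) {u : ℝ} (hu : 0 ≤ u) :
    |u * Gt γ u - 2 * Tt γ u| ≤ Kc A₁ A₂ L * Gt γ u := by
  have h := abs_Gs_mul_log_sub_le hA h1 h2 (x := Real.exp u) (by simpa using Real.one_le_exp hu)
  rw [Real.log_exp] at h
  rw [Tt_eq_Ts, Gt, mul_comm]
  exact h

/-- `G(x) ≥ 0`. [folklore] -/
theorem Gs_nonneg (h : Adm γ) (x : ℝ) : 0 ≤ Gs γ x :=
  Finset.sum_nonneg fun d _ => h.wt_nonneg d

/-- `G̃(u) ≥ 0`. [folklore] -/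
theorem Gt_nonneg (h : Adm γ) (u : ℝ) : 0 ≤ Gt γ u := Gs_nonneg h _

/-- `G̃` is non-decreasing. [folklore] -/
theorem Gt_mono (h : Adm γ) : Monotone (Gt γ) := by
  intro u v huv
  unfold Gt Gs
  refine Finset.sum_le_sum_of_subset_of_nonneg (Finset.Icc_subset_Icc_right
    (Nat.floor_mono (Real.exp_le_exp.2 huv))) fun d _ _ => h.wt_nonneg d

/-- `⌊eᵘ⌋ ≥ 1` for `u ≥ 0`. [folklore] -/
theorem one_le_floor_exp {u : ℝ} (hu : 0 ≤ u) : 1 ≤ ⌊Real.exp u⌋₊ :=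
  Nat.le_floor (by simpa using Real.one_le_exp hu)

/-- `T̃(u) ≥ u` for `u ≥ 0` (the term `d = 1`). [folklore] -/
theorem le_Tt (h : Adm γ) {u : ℝ} (hu : 0 ≤ u) : u ≤ Tt γ u := by
  unfold Tt
  have hmem : 1 ∈ Icc 1 ⌊Real.exp u⌋₊ := Finset.mem_Icc.2 ⟨le_rfl, one_le_floor_exp hu⟩
  rw [← Finset.add_sum_erase _ _ hmem]
  have h0 : 0 ≤ ∑ d ∈ (Icc 1 ⌊Real.exp u⌋₊).erase 1, wt γ d * (u - Real.log d) := by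
    refine Finset.sum_nonneg fun d hd => mul_nonneg (h.wt_nonneg d) ?_
    have hd' := Finset.mem_Icc.1 (Finset.mem_of_mem_erase hd)
    have hd0 : (0 : ℝ) < d := by exact_mod_cast hd'.1
    have : (d : ℝ) ≤ Real.exp u := le_trans (by exact_mod_cast hd'.2) (Nat.floor_le (Real.exp_pos u).le)
    have := (Real.log_le_iff_le_exp hd0).2 this
    linarith
  simp only [Nat.cast_one, Real.log_one, sub_zero, wt_one, one_mul]
  linarith

/-- `T̃` as a finite sum of hinge functions below any level `M + 1 > eᵘ`. [folklore] -/
theorem Tt_eq_sum_max {u : ℝ} {M : ℕ} (hM : Real.exp u < M + 1) :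
    Tt γ u = ∑ d ∈ Icc 1 M, wt γ d * max (u - Real.log d) 0 := by
  have hN : ⌊Real.exp u⌋₊ ≤ M :=
    Nat.le_of_lt_succ ((Nat.floor_lt (Real.exp_pos u).le).2 (by exact_mod_cast hM))
  rw [Tt, Icc_one_eq_union hN, Finset.sum_union (disjoint_Icc_one_Ioc _ _)]
  have h2 : ∑ d ∈ Ioc ⌊Real.exp u⌋₊ M, wt γ d * max (u - Real.log d) 0 = 0 := by
    refine Finset.sum_eq_zero fun d hd => ?_
    have hd' := Finset.mem_Ioc.1 hd
    have hd0 : (0 : ℝ) < d := by exact_mod_cast (lt_of_le_of_lt (Nat.zero_le _) hd'.1)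
    have hgt : Real.exp u < d := by
      have := Nat.lt_floor_add_one (Real.exp u)
      exact lt_of_lt_of_le this (by exact_mod_cast hd'.1)
    have : u < Real.log d := (Real.lt_log_iff_exp_lt hd0).2 hgt
    rw [max_eq_right (by linarith), mul_zero]
  rw [h2, add_zero]
  refine Finset.sum_congr rfl fun d hd => ?_
  have hd' := Finset.mem_Icc.1 hd
  have hd0 : (0 : ℝ) < d := by exact_mod_cast hd'.1
  have : (d : ℝ) ≤ Real.exp u := le_trans (by exact_mod_cast hd'.2) (Nat.floor_le (Real.exp_pos u).le)
  have := (Real.log_le_iff_le_exp hd0).2 this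
  rw [max_eq_left (by linarith)]

/-- `T̃` is continuous. [folklore] -/
theorem continuousOn_Tt (a b : ℝ) : ContinuousOn (Tt γ) (Set.Icc a b) := by
  set M := ⌊Real.exp b⌋₊ with hM
  have hF : Continuous fun u : ℝ => ∑ d ∈ Icc 1 M, wt γ d * max (u - Real.log d) 0 := by
    refine continuous_finsetSum _ fun d _ => ?_
    fun_prop
  refine hF.continuousOn.congr fun u hu => ?_
  refine Tt_eq_sum_max (lt_of_le_of_lt (Real.exp_le_exp.2 hu.2) ?_)
  rw [hM]; exact Nat.lt_floor_add_one _

/-- `T̃` has right derivative `G̃(u)` at every `u` (it is affine on `[u, log(⌊eᵘ⌋ + 1))`). [folklore] -/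
theorem hasDerivWithinAt_Tt (u : ℝ) : HasDerivWithinAt (Tt γ) (Gt γ u) (Set.Ici u) u := by
  set N := ⌊Real.exp u⌋₊ with hN
  set c₀ : ℝ := ∑ d ∈ Icc 1 N, wt γ d * Real.log d with hc₀
  have hℓ : HasDerivWithinAt (fun v : ℝ => v * Gt γ u - c₀) (Gt γ u) (Set.Ici u) u := by
    have : HasDerivAt (fun v : ℝ => v * Gt γ u - c₀) (Gt γ u) u := by
      simpa using ((hasDerivAt_id' u).mul_const (Gt γ u)).sub_const c₀
    exact this.hasDerivWithinAt
  have hlt : u < Real.log (N + 1) := by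
    rw [Real.lt_log_iff_exp_lt (by positivity)]
    exact_mod_cast Nat.lt_floor_add_one (Real.exp u)
  have heq : ∀ v ∈ Set.Ico u (Real.log (N + 1)), Tt γ v = v * Gt γ u - c₀ := by
    intro v hv
    have hfl : ⌊Real.exp v⌋₊ = N := by
      rw [Nat.floor_eq_iff (Real.exp_pos v).le]
      constructor
      · exact le_trans (Nat.floor_le (Real.exp_pos u).le) (Real.exp_le_exp.2 hv.1)
      · have := (Real.lt_log_iff_exp_lt (by positivity)).1 hv.2
        exact_mod_cast this
    rw [Tt, hfl, Gt, Gs, ← hN, hc₀, Finset.mul_sum, ← Finset.sum_sub_distrib]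
    exact Finset.sum_congr rfl fun d _ => by ring
  refine hℓ.congr_of_eventuallyEq ?_ (heq u ⟨le_rfl, hlt⟩)
  filter_upwards [Ico_mem_nhdsGE hlt] with v hv using heq v hv

/-! ### The slope: `G̃(u) = c u + O(cK)` -/

/-- **Slope lemma.** If `|u G̃(u) − 2T̃(u)| ≤ K G̃(u)` for all `u ≥ 0` (`K ≥ 1`), then there is
`c > 0` with `|G̃(u) − c u| ≤ 9 c K` for all `u ≥ 0`: the quotients `T̃/(u − K)²` (non-increasing)
and `T̃/(u + K)²` (non-decreasing) pinch `T̃` between `(c/2)(u ∓ K)²` on `[2K, ∞)`, and then the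
differential inequalities bound `G̃`. [folklore] -/
theorem exists_slope (hadm : Adm γ) {K : ℝ} (hK : 1 ≤ K)
    (hkey : ∀ u, 0 ≤ u → |u * Gt γ u - 2 * Tt γ u| ≤ K * Gt γ u) :
    ∃ c : ℝ, 0 < c ∧ ∀ u, 0 ≤ u → |Gt γ u - c * u| ≤ 9 * c * K := by
  have hup : ∀ x, 0 ≤ x → (x - K) * Gt γ x ≤ 2 * Tt γ x := fun x hx => by
    have := (abs_le.1 (hkey x hx)).2; linarith
  have hlo : ∀ x, 0 ≤ x → 2 * Tt γ x ≤ (x + K) * Gt γ x := fun x hx => by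
    have := (abs_le.1 (hkey x hx)).1; linarith
  have hTpos : ∀ u, 2 * K ≤ u → 0 < Tt γ u := fun u hu =>
    lt_of_lt_of_le (by linarith) (le_Tt hadm (by linarith))
  have hT0 : ∀ u, 0 ≤ u → 0 ≤ Tt γ u := fun u hu => le_trans hu (le_Tt hadm hu)
  have hanti : ∀ u₀ u₁, 2 * K ≤ u₀ → u₀ ≤ u₁ →
      Tt γ u₁ * (u₀ - K) ^ 2 ≤ Tt γ u₀ * (u₁ - K) ^ 2 := by
    intro u₀ u₁ h0 h1
    exact quad_fence_upper (by linarith) h1 (continuousOn_Tt u₀ u₁)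
      (fun x _ => hasDerivWithinAt_Tt x) (fun x hx => hup x (by linarith [hx.1])) (hTpos u₀ h0)
  have hmono : ∀ u₀ u₁, 2 * K ≤ u₀ → u₀ ≤ u₁ →
      Tt γ u₀ * (u₁ + K) ^ 2 ≤ Tt γ u₁ * (u₀ + K) ^ 2 := by
    intro u₀ u₁ h0 h1
    exact quad_fence_lower (by linarith) h1 (continuousOn_Tt u₀ u₁)
      (fun x _ => hasDerivWithinAt_Tt x) (fun x hx => hlo x (by linarith [hx.1])) (hTpos u₀ h0)
  set Φm : ℝ → ℝ := fun u => Tt γ u / (u - K) ^ 2 with hΦm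
  set Φp : ℝ → ℝ := fun u => Tt γ u / (u + K) ^ 2 with hΦp
  have hΦm_anti : ∀ u v, 2 * K ≤ u → u ≤ v → Φm v ≤ Φm u := by
    intro u v hu huv
    have h1 : 0 < (v - K) ^ 2 := by nlinarith
    have h2 : 0 < (u - K) ^ 2 := by nlinarith
    simp only [hΦm]
    rw [div_le_div_iff₀ h1 h2]
    exact hanti u v hu huv
  have hΦp_mono : ∀ u v, 2 * K ≤ u → u ≤ v → Φp u ≤ Φp v := by
    intro u v hu huv
    have h1 : 0 < (u + K) ^ 2 := by nlinarith
    have h2 : 0 < (v + K) ^ 2 := by nlinarith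
    simp only [hΦp]
    rw [div_le_div_iff₀ h1 h2]
    exact hmono u v hu huv
  have hΦpm : ∀ u, 2 * K ≤ u → Φp u ≤ Φm u := by
    intro u hu
    simp only [hΦp, hΦm]
    exact div_le_div_of_nonneg_left (hT0 u (by linarith)) (by nlinarith) (by nlinarith)
  set S := sInf (Φm '' Set.Ici (2 * K)) with hS
  have hbdd : BddBelow (Φm '' Set.Ici (2 * K)) := by
    refine ⟨0, ?_⟩
    rintro _ ⟨v, hv, rfl⟩
    exact div_nonneg (hT0 v (by simp only [Set.mem_Ici] at hv; linarith)) (sq_nonneg _)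
  have hne : (Φm '' Set.Ici (2 * K)).Nonempty := ⟨Φm (2 * K), 2 * K, Set.self_mem_Ici, rfl⟩
  have hS_le : ∀ u, 2 * K ≤ u → S ≤ Φm u := fun u hu => csInf_le hbdd ⟨u, hu, rfl⟩
  have hle_S : ∀ u, 2 * K ≤ u → Φp u ≤ S := by
    intro u hu
    refine le_csInf hne ?_
    rintro _ ⟨v, hv, rfl⟩
    rw [Set.mem_Ici] at hv
    rcases le_total u v with huv | hvu
    · exact (hΦp_mono u v hu huv).trans (hΦpm v hv)
    · exact (hΦpm u hu).trans (hΦm_anti v u hv hvu)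
  have hS_pos : 0 < S := by
    refine lt_of_lt_of_le ?_ (hle_S (2 * K) le_rfl)
    simp only [hΦp]
    exact div_pos (hTpos _ le_rfl) (by nlinarith)
  set c := 2 * S with hc
  have hc0 : 0 < c := by linarith
  have hT_lower : ∀ u, 2 * K ≤ u → S * (u - K) ^ 2 ≤ Tt γ u := by
    intro u hu
    have := hS_le u hu
    simp only [hΦm] at this
    rwa [le_div_iff₀ (by nlinarith)] at this
  have hT_upper : ∀ u, 2 * K ≤ u → Tt γ u ≤ S * (u + K) ^ 2 := by
    intro u hu
    have := hle_S u hu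
    simp only [hΦp] at this
    rwa [div_le_iff₀ (by nlinarith)] at this
  have hG_upper : ∀ u, 2 * K ≤ u → Gt γ u ≤ c * (u + 7 * K) := by
    intro u hu
    have h1 := hup u (by linarith)
    have h2 := hT_upper u hu
    have h3 : c * (u + K) ^ 2 ≤ c * ((u + 7 * K) * (u - K)) :=
      mul_le_mul_of_nonneg_left (by nlinarith) hc0.le
    have h4 : (u - K) * Gt γ u ≤ (u - K) * (c * (u + 7 * K)) := by nlinarith
    exact le_of_mul_le_mul_left h4 (by linarith)
  have hG_lower : ∀ u, 2 * K ≤ u → c * (u - 3 * K) ≤ Gt γ u := by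
    intro u hu
    have h1 := hlo u (by linarith)
    have h2 := hT_lower u hu
    have h3 : c * ((u - 3 * K) * (u + K)) ≤ c * (u - K) ^ 2 :=
      mul_le_mul_of_nonneg_left (by nlinarith) hc0.le
    have h4 : (u + K) * (c * (u - 3 * K)) ≤ (u + K) * Gt γ u := by nlinarith
    exact le_of_mul_le_mul_left h4 (by linarith)
  refine ⟨c, hc0, fun u hu => ?_⟩
  rcases le_or_gt (2 * K) u with h2K | h2K
  · have := hG_upper u h2K
    have := hG_lower u h2K
    rw [abs_le]; constructor <;> nlinarith
  · have hG1 : Gt γ u ≤ Gt γ (2 * K) := Gt_mono hadm h2K.le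
    have hG2 := hG_upper (2 * K) le_rfl
    have hG0 := Gt_nonneg hadm u
    have hcu : 0 ≤ c * u := by positivity
    have hcu2 : c * u ≤ c * (2 * K) := mul_le_mul_of_nonneg_left h2K.le hc0.le
    rw [abs_le]; constructor <;> nlinarith

/-- The slope lemma in the variable `x = eᵘ ≥ 1`. [folklore] -/
theorem exists_slope_x {A₁ A₂ L : ℝ} (hA : 0 < A₁) (h1 : HypOmega1 γ A₁) (h2 : HypOmega2 γ 1 A₂ L)
    (hK : 1 ≤ Kc A₁ A₂ L) :
    ∃ c : ℝ, 0 < c ∧ ∀ x, 1 ≤ x → |Gs γ x - c * Real.log x| ≤ 9 * c * Kc A₁ A₂ L := by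
  obtain ⟨c, hc, h⟩ := exists_slope (adm_of_hypOmega1 hA h1) hK (fun u hu => abs_Gt_sub_le hA h1 h2 hu)
  refine ⟨c, hc, fun x hx => ?_⟩
  have := h (Real.log x) (Real.log_nonneg hx)
  rwa [Gt, Real.exp_log (by linarith)] at this

/-! ### Slopes -/

/-- `G(x) = c log x + O(1)`: `c` is "the slope" of `γ`. [folklore] -/
def IsSlope (γ : ℕ → ℝ) (c : ℝ) : Prop := ∃ B : ℝ, ∀ x : ℝ, 1 ≤ x → |Gs γ x - c * Real.log x| ≤ B

/-- The slope is unique (`log x → ∞`). [folklore] -/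
theorem IsSlope.unique {γ : ℕ → ℝ} {c c' : ℝ} (h : IsSlope γ c) (h' : IsSlope γ c') : c = c' := by
  obtain ⟨B, hB⟩ := h
  obtain ⟨B', hB'⟩ := h'
  by_contra hne
  have hpos : 0 < |c - c'| := abs_pos.2 (sub_ne_zero.2 hne)
  -- take `x = exp u` with `u |c - c'| > B + B'`
  set u : ℝ := (|B| + |B'| + 1) / |c - c'| with hu
  have hu0 : 0 ≤ u := by rw [hu]; positivity
  have hx : 1 ≤ Real.exp u := by simpa using Real.one_le_exp hu0
  have e1 := hB _ hx
  have e2 := hB' _ hx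
  rw [Real.log_exp] at e1 e2
  have : |(c - c') * u| ≤ |B| + |B'| := by
    have e3 : |c * u - c' * u| ≤ B' + B := by
      calc |c * u - c' * u|
          = |(Gs γ (Real.exp u) - c' * u) - (Gs γ (Real.exp u) - c * u)| := by ring_nf
        _ ≤ |Gs γ (Real.exp u) - c' * u| + |Gs γ (Real.exp u) - c * u| := abs_sub _ _
        _ ≤ B' + B := add_le_add e2 e1
    rw [← sub_mul] at e3
    linarith [le_abs_self B, le_abs_self B']
  rw [abs_mul, abs_of_nonneg hu0, hu, mul_div_cancel₀ _ hpos.ne'] at this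
  linarith

/-- A slope bound may be taken nonnegative. [folklore] -/
theorem IsSlope.nonneg_bound {γ : ℕ → ℝ} {c : ℝ} (h : IsSlope γ c) :
    ∃ B : ℝ, 0 ≤ B ∧ ∀ x : ℝ, 1 ≤ x → |Gs γ x - c * Real.log x| ≤ B := by
  obtain ⟨B, hB⟩ := h
  exact ⟨B, le_trans (abs_nonneg _) (hB 1 le_rfl), hB⟩

/-! ### Dependence on the values at primes only -/

/-- `g(d)` depends only on `γ` at the primes dividing `d`. [folklore] -/
theorem g_congr {γ₁ γ₂ : ℕ → ℝ} {d : ℕ} (h : ∀ p ∈ d.primeFactors, γ₁ p = γ₂ p) :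
    g γ₁ d = g γ₂ d := by
  unfold g
  exact Finset.prod_congr rfl fun p hp => by rw [h p hp]

/-- `G` depends only on `γ` at primes. [folklore] -/
theorem Gs_congr {γ₁ γ₂ : ℕ → ℝ} (h : ∀ p, p.Prime → γ₁ p = γ₂ p) (x : ℝ) : Gs γ₁ x = Gs γ₂ x := by
  unfold Gs wt
  exact Finset.sum_congr rfl fun d _ => by
    rw [g_congr fun p hp => h p (Nat.prime_of_mem_primeFactors hp)]

/-- `G_q` depends only on `γ` at primes `≠ q`. [folklore] -/
theorem Gcop_congr {γ₁ γ₂ : ℕ → ℝ} {q : ℕ} (h : ∀ p, p.Prime → p ≠ q → γ₁ p = γ₂ p) (x : ℝ) :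
    Gcop γ₁ q x = Gcop γ₂ q x := by
  unfold Gcop wt
  refine Finset.sum_congr rfl fun d hd => ?_
  have hqd : ¬q ∣ d := (Finset.mem_filter.1 hd).2
  rw [g_congr fun p hp => h p (Nat.prime_of_mem_primeFactors hp) ?_]
  rintro rfl
  exact hqd (Nat.dvd_of_mem_primeFactors hp)

/-! ### The Mertens window `|∑_{w ≤ p < z} log p/p − log(z/w)| ≤ 10` -/

/-- The primes of `[a, b)` as a difference of `primesLE`. [folklore] -/
theorem filter_prime_Ico_eq_sdiff {a b : ℕ} (ha : 1 ≤ a) :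
    (Finset.Ico a b).filter Nat.Prime = Nat.primesLE (b - 1) \ Nat.primesLE (a - 1) := by
  ext p
  simp only [Finset.mem_filter, Finset.mem_Ico, Finset.mem_sdiff, Nat.mem_primesLE]
  constructor
  · rintro ⟨⟨h1, h2⟩, hp⟩; exact ⟨⟨by omega, hp⟩, fun h => by omega⟩
  · rintro ⟨⟨h1, hp⟩, h2⟩
    refine ⟨⟨?_, ?_⟩, hp⟩
    · by_contra h; exact h2 ⟨by omega, hp⟩
    · have := hp.one_lt; omega

/-- `|∑_{p ≤ n} log p/p − log n| ≤ 4` (the tree's explicit Mertens I). [folklore] -/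
theorem abs_primesLE_sum_sub_log_le {n : ℕ} (hn : 1 ≤ n) :
    |∑ p ∈ Nat.primesLE n, Real.log p / p - Real.log n| ≤ 4 := by
  have h := Literature.NumberTheory.LFunctions.MertensBound.sum_log_div_prime_bounds (t := (n : ℝ)) (by exact_mod_cast hn)
  rw [Nat.floor_natCast] at h
  rw [abs_le]; constructor <;> linarith [h.1, h.2]

/-- `log z − log 2 ≤ log(⌈z⌉ − 1) ≤ log z` for `z ≥ 2`. [folklore] -/
theorem log_ceil_sub_one_bounds {z : ℝ} (hz : 2 ≤ z) :
    Real.log z - Real.log 2 ≤ Real.log ((⌈z⌉₊ - 1 : ℕ) : ℝ) ∧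
      Real.log ((⌈z⌉₊ - 1 : ℕ) : ℝ) ≤ Real.log z := by
  have hc1 : 1 ≤ ⌈z⌉₊ := Nat.lt_ceil.2 (by exact_mod_cast (show (0 : ℝ) < z by linarith))
  have hcast : ((⌈z⌉₊ - 1 : ℕ) : ℝ) = (⌈z⌉₊ : ℝ) - 1 := by
    rw [Nat.cast_sub hc1]; simp
  rw [hcast]
  have h1 : z ≤ ⌈z⌉₊ := Nat.le_ceil z
  have h2 : (⌈z⌉₊ : ℝ) < z + 1 := Nat.ceil_lt_add_one (by linarith)
  constructor
  · rw [← Real.log_div (by linarith) (by norm_num)]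
    exact Real.log_le_log (by linarith) (by linarith)
  · exact Real.log_le_log (by linarith) (by linarith)

/-- **Mertens window**: `|∑_{w ≤ p < z} log p/p − log(z/w)| ≤ 10` for `2 ≤ w ≤ z`. [folklore] -/
theorem abs_omega2Sum_one_sub_log_le {w z : ℝ} (hw : 2 ≤ w) (hwz : w ≤ z) :
    |omega2Sum (fun _ => (1 : ℝ)) w z - Real.log (z / w)| ≤ 10 := by
  have hz : 2 ≤ z := hw.trans hwz
  set a := ⌈w⌉₊ with ha
  set b := ⌈z⌉₊ with hb
  have ha2 : 2 ≤ a := by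
    rw [ha]; exact Nat.lt_ceil.2 (by exact_mod_cast (show (1 : ℝ) < w by linarith))
  have hab : a ≤ b := Nat.ceil_mono hwz
  have hS : omega2Sum (fun _ => (1 : ℝ)) w z =
      ∑ p ∈ Nat.primesLE (b - 1), Real.log p / p - ∑ p ∈ Nat.primesLE (a - 1), Real.log p / p := by
    unfold omega2Sum
    rw [← ha, ← hb, filter_prime_Ico_eq_sdiff (by omega),
      Finset.sum_sdiff_eq_sub (Nat.primesLE_mono (by omega))]
    simp
  have e1 := abs_primesLE_sum_sub_log_le (n := b - 1) (by omega)
  have e2 := abs_primesLE_sum_sub_log_le (n := a - 1) (by omega)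
  have l1 := log_ceil_sub_one_bounds hz
  have l2 := log_ceil_sub_one_bounds hw
  rw [← hb] at l1; rw [← ha] at l2
  have hlog2 : Real.log 2 ≤ 1 := by have := Real.log_two_lt_d9; linarith
  rw [hS, Real.log_div (by linarith) (by linarith), abs_le]
  rw [abs_le] at e1 e2
  constructor <;> linarith [e1.1, e1.2, e2.1, e2.2, l1.1, l1.2, l2.1, l2.2]

/-! ### The truncated family `γ_y` -/

/-- `γ_y(p) = γ(p)` for `p < y` and `= 1` for `p ≥ y`. [folklore] -/
def trunc (γ : ℕ → ℝ) (y : ℕ) (p : ℕ) : ℝ := if p < y then γ p else 1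

/-- `γ_y(p) = γ(p)` for `p < y`. [folklore] -/
theorem trunc_of_lt {y p : ℕ} (h : p < y) : trunc γ y p = γ p := if_pos h
/-- `γ_y(p) = 1` for `p ≥ y`. [folklore] -/
theorem trunc_of_le {y p : ℕ} (h : y ≤ p) : trunc γ y p = 1 := if_neg (not_lt.2 h)

/-- `(Ω₁)` is monotone in `A₁`. [folklore] -/
theorem hypOmega1_mono {A₁ A₁' : ℝ} (hA : 0 < A₁) (hle : A₁ ≤ A₁') (h : HypOmega1 γ A₁) :
    HypOmega1 γ A₁' := by
  intro p hp
  obtain ⟨h0, h1⟩ := h p hp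
  refine ⟨h0, h1.trans ?_⟩
  have := one_div_le_one_div_of_le hA hle
  linarith

/-- `(Ω₂(1, L))` is monotone in `A₂` and `L`. [folklore] -/
theorem hypOmega2_mono {A₂ A₂' L L' : ℝ} (hA : A₂ ≤ A₂') (hL : L ≤ L') (h : HypOmega2 γ 1 A₂ L) :
    HypOmega2 γ 1 A₂' L' := by
  intro w z hw hwz
  obtain ⟨h0, h1⟩ := h w z hw hwz
  exact ⟨by linarith, by linarith⟩

/-- `γ_y` satisfies `(Ω₁)` with `max(A₁, 2)`. [folklore] -/
theorem hypOmega1_trunc {A₁ : ℝ} (hA : 0 < A₁) (h : HypOmega1 γ A₁) (y : ℕ) :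
    HypOmega1 (trunc γ y) (max A₁ 2) := by
  intro p hp
  have hp2 : (2 : ℝ) ≤ p := by exact_mod_cast hp.two_le
  have hp0 : (0 : ℝ) < p := by linarith
  by_cases hpy : p < y
  · rw [trunc_of_lt hpy]
    exact hypOmega1_mono hA (le_max_left _ _) h p hp
  · rw [trunc_of_le (not_lt.1 hpy)]
    refine ⟨by positivity, ?_⟩
    have h1 : 1 / (p : ℝ) ≤ 1 / 2 := one_div_le_one_div_of_le (by norm_num) hp2
    have h2 : 1 / max A₁ 2 ≤ 1 / 2 := one_div_le_one_div_of_le (by norm_num) (le_max_right _ _)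
    linarith

/-- Windows below `y`: `γ_y` agrees with `γ`. [folklore] -/
theorem omega2Sum_trunc_of_le {y : ℕ} {w z : ℝ} (hzy : z ≤ y) :
    omega2Sum (trunc γ y) w z = omega2Sum γ w z := by
  unfold omega2Sum
  refine Finset.sum_congr rfl fun p hp => ?_
  have hpz : p < ⌈z⌉₊ := (Finset.mem_Ico.1 (Finset.mem_filter.1 hp).1).2
  have : p < y := lt_of_lt_of_le hpz (Nat.ceil_le.2 hzy)
  rw [trunc_of_lt this]

/-- Windows above `y`: `γ_y ≡ 1`. [folklore] -/
theorem omega2Sum_trunc_of_ge {y : ℕ} {w z : ℝ} (hyw : (y : ℝ) ≤ w) :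
    omega2Sum (trunc γ y) w z = omega2Sum (fun _ => (1 : ℝ)) w z := by
  unfold omega2Sum
  refine Finset.sum_congr rfl fun p hp => ?_
  have hpw : ⌈w⌉₊ ≤ p := (Finset.mem_Ico.1 (Finset.mem_filter.1 hp).1).1
  have : y ≤ p := by
    have : (y : ℝ) ≤ p := hyw.trans ((Nat.le_ceil w).trans (by exact_mod_cast hpw))
    exact_mod_cast this
  rw [trunc_of_le this]

/-- Splitting a window at an integer point. [folklore] -/
theorem omega2Sum_split (γ' : ℕ → ℝ) {y : ℕ} {w z : ℝ} (hwy : w ≤ y) (hyz : (y : ℝ) ≤ z) :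
    omega2Sum γ' w z = omega2Sum γ' w y + omega2Sum γ' y z := by
  unfold omega2Sum
  rw [Nat.ceil_natCast, ← Finset.sum_union]
  · congr 1
    rw [← Finset.filter_union, Finset.Ico_union_Ico_eq_Ico (Nat.ceil_le.2 hwy)]
    exact_mod_cast (hyz.trans (Nat.le_ceil z))
  · exact Finset.disjoint_filter_filter (Finset.Ico_disjoint_Ico_consecutive _ _ _)

/-- **`γ_y` satisfies `(Ω₂(1, L + 10))` with `A₂ + 10`** (splitting windows at `y` and using the
Mertens window for the part `p ≥ y`). [folklore] -/
theorem hypOmega2_trunc {A₂ L : ℝ} (h : HypOmega2 γ 1 A₂ L) {y : ℕ} (hy : 2 ≤ y) :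
    HypOmega2 (trunc γ y) 1 (A₂ + 10) (L + 10) := by
  have hL := L_nonneg h
  have hA := A2_nonneg h
  intro w z hw hwz
  have hw0 : 0 < w := by linarith
  have hz0 : 0 < z := by linarith
  rcases le_or_gt z y with hzy | hyz
  · rw [omega2Sum_trunc_of_le hzy]
    obtain ⟨h0, h1⟩ := h w z hw hwz
    exact ⟨by linarith, by linarith⟩
  rcases le_or_gt (y : ℝ) w with hyw | hwy
  · rw [omega2Sum_trunc_of_ge hyw]
    have := abs_le.1 (abs_omega2Sum_one_sub_log_le hw hwz)
    exact ⟨by linarith [this.1], by linarith [this.2]⟩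
  · have hy2 : (2 : ℝ) ≤ y := by exact_mod_cast hy
    rw [omega2Sum_split _ hwy.le hyz.le, omega2Sum_trunc_of_le le_rfl,
      omega2Sum_trunc_of_ge le_rfl]
    obtain ⟨h0, h1⟩ := h w y hw hwy.le
    have hm := abs_le.1 (abs_omega2Sum_one_sub_log_le hy2 hyz.le)
    have hlog : Real.log (z / w) = Real.log (y / w) + Real.log (z / y) := by
      rw [← Real.log_mul (by positivity) (by positivity)]
      congr 1; field_simp
    rw [hlog]
    exact ⟨by linarith [hm.1], by linarith [hm.2]⟩

/-! ### The base case `γ ≡ 1`: `∑_{n ≤ x} μ²(n)/φ(n) = log x + O(1)`, i.e. slope `1` -/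

/-- For `γ ≡ 1` at the primes dividing a squarefree `n`: `g(n) = ∏_{p∣n} 1/(p−1) = w(n)/n` with the
tree's squarefree weight `w = wfun 1 cTot` (`= μ²(n) n/φ(n)`). [folklore] -/
theorem g_eq_wfun_div {γ' : ℕ → ℝ} {n : ℕ} (h : ∀ p ∈ n.primeFactors, γ' p = 1) (hn : n ≠ 0)
    (hsq : Squarefree n) :
    g γ' n = SquarefreeSums.wfun 1 SquarefreeSums.cTot n / n := by
  rw [SquarefreeSums.wfun_apply_of n hn hsq (Nat.coprime_one_right n)]
  have hnprod : (n : ℝ) = ∏ p ∈ n.primeFactors, (p : ℝ) := by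
    rw [← Nat.cast_prod, Nat.prod_primeFactors_of_squarefree hsq]
  rw [hnprod, ← Finset.prod_div_distrib, g]
  refine Finset.prod_congr rfl fun p hp => ?_
  have hpp := Nat.prime_of_mem_primeFactors hp
  have h2 : (2 : ℝ) ≤ p := by exact_mod_cast hpp.two_le
  rw [h p hp, SquarefreeSums.cTot]
  have : (p : ℝ) - 1 ≠ 0 := by linarith
  have : (p : ℝ) ≠ 0 := by linarith
  field_simp
  ring

/-- For `γ ≡ 1` on the primes: `G(x) = ∑_{n ≤ x} w(n)/n = ∑_{n ≤ x} μ²(n)/φ(n)`. [folklore] -/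
theorem Gs_eq_sum_wfun_div {γ' : ℕ → ℝ} (h : ∀ p, p.Prime → γ' p = 1) (x : ℝ) :
    Gs γ' x = ∑ n ∈ Icc 1 ⌊x⌋₊, SquarefreeSums.wfun 1 SquarefreeSums.cTot n / n := by
  unfold Gs
  refine Finset.sum_congr rfl fun n hn => ?_
  have hn0 : n ≠ 0 := by have := (Finset.mem_Icc.1 hn).1; omega
  by_cases hsq : Squarefree n
  · have hμ : ((μ n : ℤ) : ℝ) ^ 2 = 1 := by
      rw [ArithmeticFunction.moebius_apply_of_squarefree hsq]
      push_cast
      rw [← pow_mul, mul_comm, pow_mul]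
      norm_num
    rw [wt, hμ, one_mul, g_eq_wfun_div (fun p hp => h p (Nat.prime_of_mem_primeFactors hp)) hn0 hsq]
  · rw [wt_eq_zero_of_not_squarefree hsq, SquarefreeSums.wfun_eq_zero_of_not_squarefree hsq, zero_div]

/-- `b(n)/n` for the tree's `b = bfun 1 cTot` (`b * 1 = w`), as an arithmetic function. [folklore] -/
def bf : ArithmeticFunction ℝ :=
  ⟨fun n => SquarefreeSums.bfun 1 SquarefreeSums.cTot n / n, by simp⟩

/-- Unfolding `bf`. [folklore] -/
theorem bf_apply (n : ℕ) : bf n = SquarefreeSums.bfun 1 SquarefreeSums.cTot n / n := rfl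

/-- `b(n)/n` is multiplicative. [folklore] -/
theorem isMultiplicative_bf : bf.IsMultiplicative := by
  refine ⟨?_, ?_⟩
  · rw [bf_apply, SquarefreeSums.isMultiplicative_bfun.map_one]; simp
  · intro m n hmn
    rw [bf_apply, bf_apply, bf_apply, SquarefreeSums.isMultiplicative_bfun.map_mul_of_coprime hmn]
    push_cast
    rw [div_mul_div_comm]

/-- `∑ |b(n)|/n < ∞` (from the tree's moment bound `∑_{n ≤ N} |b(n)| n^{-3/4} ≤ B(2)`). [folklore] -/
theorem summable_norm_bf : Summable (fun n => ‖bf n‖) := by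
  refine summable_of_sum_range_le (f := fun n => ‖bf n‖) (c := SquarefreeSums.bConst 2)
    (fun _ => norm_nonneg _) fun N => ?_
  have h0 : ‖bf 0‖ = 0 := by simp
  rw [← Finset.sum_erase (Finset.range N) h0]
  have hsub : (Finset.range N).erase 0 ⊆ Icc 1 N := by
    intro n hn
    have h1 := Finset.mem_erase.1 hn
    have h2 := Finset.mem_range.1 h1.2
    exact Finset.mem_Icc.2 ⟨Nat.one_le_iff_ne_zero.2 h1.1, h2.le⟩
  calc ∑ n ∈ (Finset.range N).erase 0, ‖bf n‖
      ≤ ∑ n ∈ Icc 1 N, ‖bf n‖ :=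
        Finset.sum_le_sum_of_subset_of_nonneg hsub fun n _ _ => norm_nonneg _
    _ ≤ ∑ n ∈ Icc 1 N, |SquarefreeSums.bfun 1 SquarefreeSums.cTot n| * (n : ℝ) ^ (-(3 : ℝ) / 4) := by
        refine Finset.sum_le_sum fun n hn => ?_
        have hn1 : 1 ≤ n := (Finset.mem_Icc.1 hn).1
        rw [bf_apply, norm_div, Real.norm_eq_abs, Real.norm_eq_abs,
          abs_of_pos (by exact_mod_cast hn1 : (0 : ℝ) < n), div_eq_mul_one_div]
        exact mul_le_mul_of_nonneg_left (SquarefreeSums.inv_le_rpow_neg hn1) (abs_nonneg _)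
    _ ≤ SquarefreeSums.bConst 2 :=
        SquarefreeSums.sum_babs_le (W := 1) (fun p hp => SquarefreeSums.abs_cTot_le p hp) N

/-- The local factors of `∑ b(n)/n` are `1 + 1/(p(p−1)) − 1/(p(p−1)) = 1`. [folklore] -/
theorem tsum_bf_prime_pow {p : ℕ} (hp : p.Prime) : ∑' e, bf (p ^ e) = 1 := by
  have hvan : ∀ e ∉ Finset.range 3, bf (p ^ e) = 0 := by
    intro e he
    rw [Finset.mem_range, not_lt] at he
    rw [bf_apply, SquarefreeSums.bfun_apply_prime_pow hp (by omega),
      if_neg (by rw [Nat.dvd_one]; exact hp.ne_one), SquarefreeSums.bloc]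
    rw [if_neg (by omega), if_neg (by omega), if_neg (by omega), zero_div]
  rw [tsum_eq_sum hvan, Finset.sum_range_succ, Finset.sum_range_succ, Finset.sum_range_succ,
    Finset.sum_range_zero, zero_add, pow_zero, pow_one]
  have h0 : bf 1 = 1 := isMultiplicative_bf.map_one
  have h1 : bf p = SquarefreeSums.cTot p / p := by
    rw [bf_apply]
    have := SquarefreeSums.bfun_apply_prime_pow (W := 1) (c := SquarefreeSums.cTot) hp one_ne_zero
    rw [pow_one] at this
    rw [this, if_neg (by rw [Nat.dvd_one]; exact hp.ne_one), SquarefreeSums.bloc]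
    simp
  have h2 : bf (p ^ 2) = -(1 + SquarefreeSums.cTot p) / (p : ℝ) ^ 2 := by
    rw [bf_apply, SquarefreeSums.bfun_apply_prime_pow hp two_ne_zero,
      if_neg (by rw [Nat.dvd_one]; exact hp.ne_one), SquarefreeSums.bloc]
    push_cast
    simp
  rw [h0, h1, h2, SquarefreeSums.cTot]
  have hp2 : (2 : ℝ) ≤ p := by exact_mod_cast hp.two_le
  have : (p : ℝ) - 1 ≠ 0 := by linarith
  have : (p : ℝ) ≠ 0 := by linarith
  field_simp
  ring

/-- `∑_n b(n)/n = ∏_p 1 = 1`. [folklore] -/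
theorem tsum_bf : ∑' n, bf n = 1 := by
  have h := isMultiplicative_bf.eulerProduct summable_norm_bf
  have h1 : (fun n : ℕ => ∏ p ∈ Nat.primesBelow n, ∑' e, bf (p ^ e)) = fun _ => (1 : ℝ) := by
    funext n
    exact Finset.prod_eq_one fun p hp => tsum_bf_prime_pow (Nat.prime_of_mem_primesBelow hp)
  rw [h1] at h
  exact (tendsto_nhds_unique tendsto_const_nhds h).symm

/-- `∑_{1 ≤ n ≤ N} f(n) = ∑_{n < N+1} f(n)` when `f(0) = 0`. [folklore] -/
theorem sum_Icc_eq_sum_range {f : ℕ → ℝ} (h0 : f 0 = 0) (N : ℕ) :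
    ∑ n ∈ Icc 1 N, f n = ∑ n ∈ Finset.range (N + 1), f n := by
  have : Icc 1 N = Finset.Ico 1 (N + 1) := by
    ext n; simp only [Finset.mem_Icc, Finset.mem_Ico]; omega
  rw [this, Finset.sum_Ico_eq_sub _ (by omega)]
  simp [h0]

/-- `β(x) = ∑_{d ≤ x} b(d)/d → 1`. [folklore] -/
theorem tendsto_bsum :
    Tendsto (fun x : ℝ => SquarefreeSums.bsum 1 SquarefreeSums.cTot x) atTop (𝓝 1) := by
  have hsum : HasSum (fun n => bf n) 1 := by
    rw [← tsum_bf]; exact summable_norm_bf.of_norm.hasSum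
  have h1 := hsum.tendsto_sum_nat
  have h2 : Tendsto (fun x : ℝ => ⌊x⌋₊ + 1) atTop atTop :=
    (tendsto_add_atTop_nat 1).comp tendsto_nat_floor_atTop
  have h3 := h1.comp h2
  refine h3.congr fun x => ?_
  simp only [Function.comp, SquarefreeSums.bsum_def]
  rw [← sum_Icc_eq_sum_range (by simp)]
  rfl

/-- **The slope of `γ ≡ 1` is `1`**: combine `IsSlope γ' c` with the tree's
`|∑_{n ≤ x} w(n)/n − β(x) log x| ≤ E` (`SquarefreeSums.abs_sum_wfun_div_sub_le`) and `β(x) → 1`. [folklore] -/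
theorem slope_eq_one {γ' : ℕ → ℝ} (hγ : ∀ p, p.Prime → γ' p = 1) {c : ℝ} (hc : IsSlope γ' c) :
    c = 1 := by
  obtain ⟨B, hB⟩ := hc
  set E : ℝ := (SquarefreeSums.harmErr 1 + 4) * SquarefreeSums.bConst 2 with hE
  set β : ℝ → ℝ := fun x => SquarefreeSums.bsum 1 SquarefreeSums.cTot x with hβ
  have hbound : ∀ x : ℝ, 1 < x → |β x - c| ≤ (B + E) / Real.log x := by
    intro x hx
    have hlog : 0 < Real.log x := Real.log_pos hx
    have e1 := hB x hx.le
    have e2 := SquarefreeSums.abs_sum_wfun_div_sub_le (W := 1) (c := SquarefreeSums.cTot)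
      one_ne_zero (fun p hp => SquarefreeSums.abs_cTot_le p hp) hx.le
    rw [← Gs_eq_sum_wfun_div hγ, Nat.totient_one, Nat.cast_one, div_one, one_mul] at e2
    rw [le_div_iff₀ hlog]
    have : |(β x - c) * Real.log x| ≤ B + E := by
      calc |(β x - c) * Real.log x|
          = |(Gs γ' x - c * Real.log x) - (Gs γ' x - β x * Real.log x)| := by ring_nf
        _ ≤ |Gs γ' x - c * Real.log x| + |Gs γ' x - β x * Real.log x| := abs_sub _ _
        _ ≤ B + E := add_le_add e1 e2
    rwa [abs_mul, abs_of_pos hlog] at this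
  have hlim : Tendsto β atTop (𝓝 c) := by
    rw [tendsto_iff_norm_sub_tendsto_zero]
    have hg : Tendsto (fun x => (B + E) / Real.log x) atTop (𝓝 0) :=
      tendsto_const_nhds.div_atTop Real.tendsto_log_atTop
    refine squeeze_zero' (Eventually.of_forall fun _ => norm_nonneg _) ?_ hg
    filter_upwards [eventually_gt_atTop 1] with x hx
    rw [Real.norm_eq_abs]
    exact hbound x hx
  exact tendsto_nhds_unique hlim tendsto_bsum

/-! ### One prime at a time: the slope of `γ_{q+1}` from that of `γ_q` -/

/-- `γ_{y+1}` and `γ_y` agree away from `y`. [folklore] -/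
theorem trunc_succ_of_ne {y p : ℕ} (hp : p ≠ y) : trunc γ (y + 1) p = trunc γ y p := by
  unfold trunc
  by_cases h : p < y
  · rw [if_pos (Nat.lt_succ_of_lt h), if_pos h]
  · have : ¬p < y + 1 := by omega
    rw [if_neg this, if_neg h]

/-- `G_q(x) ≥ 0`. [folklore] -/
theorem Gcop_nonneg {γ' : ℕ → ℝ} (h : Adm γ') (q : ℕ) (x : ℝ) : 0 ≤ Gcop γ' q x :=
  Finset.sum_nonneg fun d _ => h.wt_nonneg d

/-- `G_q` is non-decreasing in `x`. [folklore] -/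
theorem Gcop_mono {γ' : ℕ → ℝ} (h : Adm γ') (q : ℕ) {x y : ℝ} (hxy : x ≤ y) :
    Gcop γ' q x ≤ Gcop γ' q y := by
  unfold Gcop
  exact Finset.sum_le_sum_of_subset_of_nonneg
    (Finset.filter_subset_filter _ (Finset.Icc_subset_Icc_right (Nat.floor_mono hxy)))
    fun d _ _ => h.wt_nonneg d

/-- `G_q(x) = 0` for `x < 1`. [folklore] -/
theorem Gcop_eq_zero_of_lt_one {γ' : ℕ → ℝ} (q : ℕ) {x : ℝ} (hx : x < 1) : Gcop γ' q x = 0 := by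
  unfold Gcop
  have : ⌊x⌋₊ = 0 := Nat.floor_eq_zero.2 hx
  rw [this]; simp

/-- **Induction step.** If `γ_q` has slope `c ≥ 0` (`q` prime), then `γ_{q+1}` has slope
`c (1 − 1/q)(1 + g(q))`: with `U(x) = ∑_{d ≤ x, q ∤ d} a(d)` (the same for both),
`G_q = U + U(·/q)/(q−1)` and `G_{q+1} = U + g(q) U(·/q)`, and `U` is pinched by
`(q/(q−1)) U(x/q) ≤ G_q(x) ≤ (q/(q−1)) U(x)`. [folklore] -/
theorem isSlope_step {A₁ : ℝ} (hA : 0 < A₁) (h1 : HypOmega1 γ A₁) {q : ℕ} (hq : q.Prime)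
    {c : ℝ} (hc : 0 ≤ c) (h : IsSlope (trunc γ q) c) :
    IsSlope (trunc γ (q + 1)) (c * (1 - 1 / q) * (1 + g γ q)) := by
  obtain ⟨B, hB0, hB⟩ := h.nonneg_bound
  have hA' : 0 < max A₁ 2 := lt_max_of_lt_right (by norm_num)
  have hadm : Adm (trunc γ q) := adm_of_hypOmega1 hA' (hypOmega1_trunc hA h1 q)
  have hadmγ : Adm γ := adm_of_hypOmega1 hA h1
  set U : ℝ → ℝ := fun x => Gcop (trunc γ q) q x with hU
  have hU' : ∀ x, Gcop (trunc γ (q + 1)) q x = U x := fun x =>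
    Gcop_congr (fun p _ hpq => trunc_succ_of_ne hpq) x
  have hr2 : (2 : ℝ) ≤ q := by exact_mod_cast hq.two_le
  have hr0 : (0 : ℝ) < q := by linarith
  have hr1 : (1 : ℝ) < q := by linarith
  set κ : ℝ := (q : ℝ) / (q - 1) with hκ
  have hκ1 : 1 ≤ κ := by rw [hκ, le_div_iff₀ (by linarith)]; linarith
  have hκ0 : 0 < κ := by linarith
  have hq1 : (q : ℝ) - 1 ≠ 0 := by linarith
  have hgq : g (trunc γ q) q = κ - 1 := by
    rw [g_prime _ hq, trunc_of_le le_rfl, hκ]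
    field_simp
    ring
  have hg' : g (trunc γ (q + 1)) q = g γ q := by
    rw [g_prime _ hq, g_prime _ hq, trunc_of_lt (Nat.lt_succ_self q)]
  have hinvκ : 1 - 1 / (q : ℝ) = 1 / κ := by
    rw [hκ]; field_simp
  have hG : ∀ x, Gs (trunc γ q) x = U x + (κ - 1) * U (x / q) := fun x => by
    rw [Gs_eq_Gcop_add hq x, hgq]
  have hG' : ∀ x, Gs (trunc γ (q + 1)) x = U x + g γ q * U (x / q) := fun x => by
    rw [Gs_eq_Gcop_add hq x, hg', hU', hU']
  have hUmono : ∀ x y, x ≤ y → U x ≤ U y := fun x y hxy => Gcop_mono hadm q hxy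
  have hU0 : ∀ x, 0 ≤ U x := fun x => Gcop_nonneg hadm q x
  have hlogq : 0 ≤ Real.log q := Real.log_nonneg hr1.le
  have hclog : 0 ≤ c * Real.log q := mul_nonneg hc hlogq
  -- the pinching of `U`
  have hUbound : ∀ x, 1 ≤ x → |U x - c / κ * Real.log x| ≤ B + c * Real.log q := by
    intro x hx
    have hx0 : 0 < x := by linarith
    have e1 := abs_le.1 (hB x hx)
    have hGx : Gs (trunc γ q) x ≤ κ * U x := by
      rw [hG]
      have := hUmono (x / q) x (div_le_self hx0.le hr1.le)
      nlinarith
    have hqx : 1 ≤ (q : ℝ) * x := by nlinarith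
    have e2 := abs_le.1 (hB (q * x) hqx)
    have hGqx : κ * U x ≤ Gs (trunc γ q) (q * x) := by
      rw [hG (q * x), mul_div_cancel_left₀ x hr0.ne']
      have := hUmono x (q * x) (le_mul_of_one_le_left hx0.le hr1.le)
      nlinarith
    rw [Real.log_mul hr0.ne' hx0.ne'] at e2
    rw [abs_le]
    constructor
    · have h3 : c / κ * Real.log x - B / κ ≤ U x := by
        rw [div_mul_eq_mul_div, ← sub_div, div_le_iff₀ hκ0]
        nlinarith [e1.1]
      have hBκ : B / κ ≤ B := div_le_self hB0 hκ1
      linarith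
    · have h3 : U x ≤ c / κ * Real.log x + (c * Real.log q + B) / κ := by
        rw [div_mul_eq_mul_div, ← add_div, le_div_iff₀ hκ0]
        nlinarith [e2.2]
      have h4 : (c * Real.log q + B) / κ ≤ c * Real.log q + B := div_le_self (by linarith) hκ1
      linarith
  have hcκ : c / κ ≤ c := div_le_self hc hκ1
  have hcκ0 : 0 ≤ c / κ := div_nonneg hc hκ0.le
  have hUq : ∀ x, 1 ≤ x → |U (x / q) - c / κ * Real.log x| ≤ B + 2 * c * Real.log q := by
    intro x hx
    have hx0 : 0 < x := by linarith
    rcases le_or_gt 1 (x / q) with hxq | hxq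
    · have e := abs_le.1 (hUbound (x / q) hxq)
      rw [Real.log_div hx0.ne' hr0.ne', mul_sub] at e
      have : c / κ * Real.log q ≤ c * Real.log q := mul_le_mul_of_nonneg_right hcκ hlogq
      have : 0 ≤ c / κ * Real.log q := mul_nonneg hcκ0 hlogq
      rw [abs_le]; constructor <;> linarith [e.1, e.2]
    · have hxq' : x < q := by rwa [div_lt_one hr0] at hxq
      rw [show U (x / q) = 0 from Gcop_eq_zero_of_lt_one q hxq]
      have hlogx : Real.log x ≤ Real.log q := Real.log_le_log hx0 hxq'.le
      have hlogx0 : 0 ≤ Real.log x := Real.log_nonneg hx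
      have h1' : 0 ≤ c / κ * Real.log x := mul_nonneg hcκ0 hlogx0
      have h2' : c / κ * Real.log x ≤ c * Real.log q := mul_le_mul hcκ hlogx hlogx0 hc
      rw [zero_sub, abs_neg, abs_of_nonneg h1']
      linarith
  have hg0 : 0 ≤ g γ q := hadmγ.g_prime_nonneg hq
  refine ⟨(B + c * Real.log q) + g γ q * (B + 2 * c * Real.log q), fun x hx => ?_⟩
  rw [hG' x, hinvκ]
  calc |U x + g γ q * U (x / q) - c * (1 / κ) * (1 + g γ q) * Real.log x|
      = |(U x - c / κ * Real.log x) + g γ q * (U (x / q) - c / κ * Real.log x)| := by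
        congr 1; ring
    _ ≤ |U x - c / κ * Real.log x| + |g γ q * (U (x / q) - c / κ * Real.log x)| := abs_add_le _ _
    _ = |U x - c / κ * Real.log x| + g γ q * |U (x / q) - c / κ * Real.log x| := by
        rw [abs_mul, abs_of_nonneg hg0]
    _ ≤ (B + c * Real.log q) + g γ q * (B + 2 * c * Real.log q) :=
        add_le_add (hUbound x hx) (mul_le_mul_of_nonneg_left (hUq x hx) hg0)

/-! ### The slopes of the `γ_y` are the partial products of `c_γ` -/

/-- The partial products of `c_γ` are nonnegative. [folklore] -/
theorem Adm.cGammaPartial_nonneg (h : Adm γ) (y : ℕ) : 0 ≤ cGammaPartial γ y := by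
  unfold cGammaPartial
  refine Finset.prod_nonneg fun p hp => ?_
  have hpp := Nat.prime_of_mem_primesBelow hp
  have hp0 : (0 : ℝ) < p := by exact_mod_cast hpp.pos
  have h1 : 0 < 1 - γ p / p := by
    rw [_root_.sub_pos, div_lt_one hp0]; exact (h p hpp).2
  have h2 : 0 ≤ 1 - 1 / (p : ℝ) := by
    rw [_root_.sub_nonneg, div_le_one hp0]; exact_mod_cast hpp.one_lt.le
  exact mul_nonneg (inv_nonneg.2 h1.le) h2

/-- One more prime in the partial product of `c_γ`: the factor `(1 − γ(y)/y)⁻¹(1 − 1/y) = (1 + g(y))(1 − 1/y)`. [folklore] -/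
theorem cGammaPartial_succ (h : Adm γ) (y : ℕ) :
    cGammaPartial γ (y + 1) =
      if y.Prime then (1 + g γ y) * (1 - 1 / y) * cGammaPartial γ y else cGammaPartial γ y := by
  unfold cGammaPartial
  rw [Nat.primesBelow_succ]
  split_ifs with hy
  · rw [Finset.prod_insert (Nat.notMem_primesBelow y), h.one_sub_div_inv hy]
  · rfl

/-- The empty partial product is `1`. [folklore] -/
theorem cGammaPartial_two (γ : ℕ → ℝ) : cGammaPartial γ 2 = 1 := by
  simp [cGammaPartial]

/-- **Slopes of the truncations**: if `γ_2 ≡ 1` has a slope at all, then for every `y ≥ 2` the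
slope of `γ_y` is `∏_{p<y} (1 − γ(p)/p)⁻¹ (1 − 1/p) = cGammaPartial γ y`. [folklore] -/
theorem isSlope_trunc {A₁ : ℝ} (hA : 0 < A₁) (h1 : HypOmega1 γ A₁)
    (hbase : ∃ c, IsSlope (trunc γ 2) c) {y : ℕ} (hy : 2 ≤ y) :
    IsSlope (trunc γ y) (cGammaPartial γ y) := by
  have hadm : Adm γ := adm_of_hypOmega1 hA h1
  induction y, hy using Nat.le_induction with
  | base =>
    obtain ⟨c, hc⟩ := hbase
    have : c = 1 := slope_eq_one (fun p hp => trunc_of_le hp.two_le) hc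
    rw [cGammaPartial_two, ← this]
    exact hc
  | succ y hy ih =>
    rw [cGammaPartial_succ hadm]
    by_cases hyp : y.Prime
    · rw [if_pos hyp]
      have := isSlope_step hA h1 hyp (hadm.cGammaPartial_nonneg y) ih
      convert this using 1
      ring
    · rw [if_neg hyp]
      obtain ⟨B, hB⟩ := ih
      refine ⟨B, fun x hx => ?_⟩
      rw [Gs_congr (fun p hp => trunc_succ_of_ne (by rintro rfl; exact hyp hp))]
      exact hB x hx

/-- `G_γ(x) = G_{γ_y}(x)` as long as `x < y`. [folklore] -/
theorem Gs_trunc_eq {y : ℕ} {x : ℝ} (hxy : ⌊x⌋₊ < y) : Gs (trunc γ y) x = Gs γ x := by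
  unfold Gs wt
  refine Finset.sum_congr rfl fun d hd => ?_
  have hd' := Finset.mem_Icc.1 hd
  rw [g_congr]
  intro p hp
  have hpd : p ≤ d := Nat.le_of_dvd (by omega) (Nat.dvd_of_mem_primeFactors hp)
  exact trunc_of_lt (by omega)

/-! ### Assembly -/

/-- `∑_{d<z} μ² g(d) = G(⌈z⌉ − 1)`. [folklore] -/
theorem moebiusSqGSum_eq_Gs (γ : ℕ → ℝ) (z : ℝ) :
    moebiusSqGSum γ z = Gs γ ((⌈z⌉₊ - 1 : ℕ) : ℝ) := by
  unfold moebiusSqGSum Gs wt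
  rw [Nat.floor_natCast]
  refine Finset.sum_congr ?_ fun _ _ => rfl
  ext d; simp only [Finset.mem_Ico, Finset.mem_Icc]; omega

/-- The constant `C₃(A₁, A₂)`: `K(max(A₁,2), A₂ + 10, L + 10) = L + C₃`. [folklore] -/
def C3 (A₁ A₂ : ℝ) : ℝ := A₂ + 21 + C1 (max A₁ 2) (A₂ + 10)

/-- `K(max(A₁,2), A₂ + 10, L + 10) = L + C₃(A₁, A₂)`. [folklore] -/
theorem Kc_eq (A₁ A₂ L : ℝ) : Kc (max A₁ 2) (A₂ + 10) (L + 10) = L + C3 A₁ A₂ := by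
  unfold Kc C3; ring

/-- `⌊y − 1/2⌋ = y − 1` for an integer `y ≥ 1`. [folklore] -/
theorem floor_natCast_sub_half {y : ℕ} (hy : 1 ≤ y) : ⌊(y : ℝ) - 1 / 2⌋₊ = y - 1 := by
  have hy1 : (1 : ℝ) ≤ y := by exact_mod_cast hy
  rw [Nat.floor_eq_iff (by linarith), Nat.cast_sub hy]
  push_cast
  constructor <;> linarith

end Lemma3

open Lemma3 in
/-- **Goldston–Graham–Pintz–Yıldırım 2009, Lemma 3 (`κ = 1`) = Halberstam–Richert, Lemmas 5.3–5.4,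
PROVED**: the named fact `GGPY.moebiusSqGSum_asymptotic` holds. Elementary proof (not the one in
Halberstam–Richert): (a) the Chebyshev-type identity
`∑_{d≤x} μ²g(d) log d = ∑_{m≤x} μ²g(m) θ_γ(x/m) + D(x)` with `0 ≤ D ≤ C₁ G` (a window estimate from
`(Ω₂)` on `[√y, y]`), whence `|G log x − 2T| ≤ K G` with `T(x) = ∫_1^x G dt/t`, `K = L + O(1)`;
(b) the quotients `T/(log x ∓ K)²` are monotone (fencing argument on the right derivative), which
pins `T` and then `G = c log x + O(cK)`; (c) the constant: truncating `γ` to `1` above `y` changes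
the slope prime by prime by the factors `(1 − γ(p)/p)⁻¹(1 − 1/p)`, the slope of `γ ≡ 1` is `1`
(`∑ μ²/φ ∼ log x`, from the tree's coprime squarefree sums and the Euler product `∑ b(n)/n = 1`),
and comparing `G_γ = G_{γ_y}` below `y` gives `∏_{p<y} (1 − γ(p)/p)⁻¹(1 − 1/p) → c`.
[cite: GoldstonEtAl2008, Lemma 3 (κ = 1)] -/
theorem moebiusSqGSum_asymptotic_holds : moebiusSqGSum_asymptotic := by
  intro A₁ A₂ hA₁ hA₂
  refine ⟨10 + 9 * C3 A₁ A₂, fun L hL γ h1 h2 => ?_⟩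
  set A₁' := max A₁ 2 with hA₁'
  set K := L + C3 A₁ A₂ with hK
  have hA' : 0 < A₁' := lt_max_of_lt_left hA₁
  have hA2 : 0 ≤ A₂ := A2_nonneg h2
  have hC1 : 0 ≤ C1 A₁' (A₂ + 10) := C1_nonneg hA' (by linarith)
  have hC3 : 0 ≤ C3 A₁ A₂ := by unfold C3; linarith
  have hK1 : 1 ≤ K := by rw [hK]; linarith
  have hKc : Kc A₁' (A₂ + 10) (L + 10) = K := Kc_eq A₁ A₂ L
  have hadm : Adm γ := adm_of_hypOmega1 hA₁ h1
  have h1γ : HypOmega1 γ A₁' := hypOmega1_mono hA₁ (le_max_left _ _) h1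
  have h2γ : HypOmega2 γ 1 (A₂ + 10) (L + 10) := hypOmega2_mono (by linarith) (by linarith) h2
  have h1y : ∀ y, HypOmega1 (trunc γ y) A₁' := hypOmega1_trunc hA₁ h1
  have h2y : ∀ y, 2 ≤ y → HypOmega2 (trunc γ y) 1 (A₂ + 10) (L + 10) := fun y hy =>
    hypOmega2_trunc h2 hy
  -- the slope of `γ`
  obtain ⟨c, hc0, hc⟩ := exists_slope_x hA' h1γ h2γ (hKc ▸ hK1)
  rw [hKc] at hc
  -- the slopes of the truncations
  have hbase : ∃ c₂, IsSlope (trunc γ 2) c₂ := by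
    obtain ⟨c₂, -, hc₂⟩ := exists_slope_x hA' (h1y 2) (h2y 2 le_rfl) (hKc ▸ hK1)
    exact ⟨c₂, _, hc₂⟩
  have hslope_y : ∀ y, 2 ≤ y → ∀ x, 1 ≤ x →
      |Gs (trunc γ y) x - cGammaPartial γ y * Real.log x| ≤ 9 * cGammaPartial γ y * K := by
    intro y hy
    obtain ⟨c', -, hc'⟩ := exists_slope_x hA' (h1y y) (h2y y hy) (hKc ▸ hK1)
    rw [hKc] at hc'
    have hs : IsSlope (trunc γ y) (cGammaPartial γ y) := isSlope_trunc hA₁ h1 hbase hy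
    have hs' : IsSlope (trunc γ y) c' := ⟨_, hc'⟩
    rw [hs.unique hs']
    exact hc'
  -- convergence of the partial products to `c`
  have hcmp : ∀ y : ℕ, 2 ≤ y →
      |c - cGammaPartial γ y| * Real.log ((y : ℝ) - 1 / 2) ≤ 9 * K * (c + cGammaPartial γ y) := by
    intro y hy
    have hy2 : (2 : ℝ) ≤ y := by exact_mod_cast hy
    set x : ℝ := (y : ℝ) - 1 / 2 with hx
    have hx1 : 1 ≤ x := by rw [hx]; linarith
    have hfl : ⌊x⌋₊ < y := by
      rw [hx, floor_natCast_sub_half (by omega)]; omega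
    have e1 := hc x hx1
    have e2 := hslope_y y hy x hx1
    rw [Gs_trunc_eq hfl] at e2
    have hlog0 : 0 ≤ Real.log x := Real.log_nonneg hx1
    calc |c - cGammaPartial γ y| * Real.log x
        = |(Gs γ x - cGammaPartial γ y * Real.log x) - (Gs γ x - c * Real.log x)| := by
          rw [show (Gs γ x - cGammaPartial γ y * Real.log x) - (Gs γ x - c * Real.log x) =
            (c - cGammaPartial γ y) * Real.log x by ring, abs_mul, abs_of_nonneg hlog0]
      _ ≤ |Gs γ x - cGammaPartial γ y * Real.log x| + |Gs γ x - c * Real.log x| := abs_sub _ _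
      _ ≤ 9 * cGammaPartial γ y * K + 9 * c * K := add_le_add e2 e1
      _ = 9 * K * (c + cGammaPartial γ y) := by ring
  have hbound : ∀ y : ℕ, 2 ≤ y → 18 * K ≤ Real.log ((y : ℝ) - 1 / 2) →
      |cGammaPartial γ y - c| ≤ 36 * c * K / Real.log ((y : ℝ) - 1 / 2) := by
    intro y hy hlog
    set lg := Real.log ((y : ℝ) - 1 / 2) with hlg
    have hlgpos : 0 < lg := by linarith
    have e := hcmp y hy
    have hP0 : 0 ≤ cGammaPartial γ y := hadm.cGammaPartial_nonneg y
    have hP3 : cGammaPartial γ y ≤ 3 * c := by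
      have h1' : (cGammaPartial γ y - c) * lg ≤ 9 * K * (c + cGammaPartial γ y) := by
        refine le_trans ?_ e
        rw [abs_sub_comm]
        exact mul_le_mul_of_nonneg_right (le_abs_self _) hlgpos.le
      nlinarith
    rw [le_div_iff₀ hlgpos, abs_sub_comm]
    calc |c - cGammaPartial γ y| * lg ≤ 9 * K * (c + cGammaPartial γ y) := e
      _ ≤ 36 * c * K := by nlinarith
  have hlogt : Tendsto (fun y : ℕ => Real.log ((y : ℝ) - 1 / 2)) atTop atTop := by
    refine Real.tendsto_log_atTop.comp ?_
    have := tendsto_atTop_add_const_right atTop (-(1 / 2 : ℝ)) tendsto_natCast_atTop_atTop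
    simpa [sub_eq_add_neg] using this
  have hconv : Tendsto (cGammaPartial γ) atTop (𝓝 c) := by
    rw [tendsto_iff_norm_sub_tendsto_zero]
    have hg : Tendsto (fun y : ℕ => 36 * c * K / Real.log ((y : ℝ) - 1 / 2)) atTop (𝓝 0) :=
      tendsto_const_nhds.div_atTop hlogt
    refine squeeze_zero' (Eventually.of_forall fun _ => norm_nonneg _) ?_ hg
    filter_upwards [eventually_ge_atTop 2, hlogt.eventually (eventually_ge_atTop (18 * K))]
      with y hy hlog
    rw [Real.norm_eq_abs]
    exact hbound y hy hlog
  have hcγ : cGamma γ = c := hconv.limUnder_eq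
  refine ⟨by rw [hcγ]; exact hconv, fun z hz => ?_⟩
  rw [hcγ, moebiusSqGSum_eq_Gs]
  have hc1 : 2 ≤ ⌈z⌉₊ := Nat.lt_ceil.2 (by exact_mod_cast (show (1 : ℝ) < z by linarith))
  set n : ℕ := ⌈z⌉₊ - 1 with hn
  have hn1 : (1 : ℝ) ≤ n := by rw [hn]; exact_mod_cast (show 1 ≤ ⌈z⌉₊ - 1 by omega)
  have e1 := hc n hn1
  have hl := log_ceil_sub_one_bounds hz
  rw [← hn] at hl
  have hlog2 : Real.log 2 ≤ 1 := by have := Real.log_two_lt_d9; linarith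
  calc |Gs γ n - c * Real.log z|
      ≤ |Gs γ n - c * Real.log n| + |c * Real.log n - c * Real.log z| := abs_sub_le _ _ _
    _ ≤ 9 * c * K + c * 1 := by
        refine add_le_add e1 ?_
        rw [← mul_sub, abs_mul, abs_of_pos hc0]
        refine mul_le_mul_of_nonneg_left ?_ hc0.le
        rw [abs_le]; constructor <;> linarith [hl.1, hl.2]
    _ = c * (9 * K + 1) := by ring
    _ ≤ (10 + 9 * C3 A₁ A₂) * c * L := by
        rw [hK]
        have : 9 * (L + C3 A₁ A₂) + 1 ≤ (10 + 9 * C3 A₁ A₂) * L := by nlinarith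
        nlinarith

end GGPY
end Literature.NumberTheory.Sieve
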